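import Literature.NumberTheory.Sieve.FriedlanderIwaniecPrimesQuadCongr
import Literature.NumberTheory.Sieve.FriedlanderIwaniecPrimesLatticeCount
import Literature.NumberTheory.Sieve.RamanujanSum
import HarnessLib

/-!
# Friedlander–Iwaniec, *The polynomial `X² + Y⁴` captures its primes*, §8: the arithmetic sum `G(h₁, h₂)` — Lemma 8.1 and (8.6) in crude form

Family `parity`, statement parity.S17 (`setOf_prime_sq_add_pow_four_infinite`). Source: J. Friedlander,
H. Iwaniec, Ann. of Math. (2) 148 (1998), 945–1040 [FriedlanderIwaniecAnnals1998], §8 "The arithmetic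
sum `G(h₁, h₂)`", pp. 977–979 (arXiv math/9811185 pp. 28–29): "Recall that `G(h₁, h₂)` is given by
(6.10). This is a kind of Weyl sum for the equidistribution of roots `γ₁, γ₂` of the quadratic form
`γ₁² z₂ - γ₂² z₁` modulo `|Δ|` … Changing `η₂` into `ω η₁` we conclude that `G(h₁, h₂)` is given by
(8.3) … where `R(h; b)` denotes the Ramanujan sum … Using the well-known bound `|R(h; b)| ≤ (h, b)`
… LEMMA 8.1. For any `h₁, h₂` the exponential sum (6.10) satisfies (8.5)
`|G(h₁, h₂)| ≤ 4 τ₃(Δ) |Δ|⁻¹ (z₁ h₁² - z₂ h₂², Δ)`. In particular for `h₁ = h₂ = 0` the estimate (8.5)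
becomes (8.6) `G₀(z₁, z₂) ≤ 4 τ₃(Δ)`."

This file PROVES Lemma 8.1 and (8.6) with the divisor factor `τ(|Δ|)⁴` in place of `4 τ₃(Δ)`
(`norm_gExpSum_le`, `gCount_le`); downstream (§9, (10.4)) only the shape `τ(Δ)^c (Λ, Δ)/|Δ|` is used
(the source itself continues with "`τ₃(Δ) ≪ τ(d)^{16}`", (10.9)). Everything is PROVED; there are no
named facts. The objects are those of `…LatticeCount` ((6.3)–(6.7): `det2`, `CongrPair` on `ℤ × ℤ`).

## The argument

* **(6.6)** (`exists_ratio_mod_det`, `isCoprime_ratio`, `congrPair_iff_dvd`): for `(Δ, |z₁|²) = 1`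
  there is a rational integer `a` with `z₂ ≡ a z₁ (mod Δ)`, prime to `Δ` when also `(Δ, |z₂|²) = 1`,
  and the Gaussian congruence (6.4) `c₁² z₂ ≡ c₂² z₁ (mod |Δ|)` is the single rational congruence
  `a c₁² ≡ c₂² (mod |Δ|)` ((8.8)). Hence `|Δ| G(h₁, h₂) = S_{|Δ|}(a; h₁, h₂)` (`gExpSum_eq_quadExpSum`)
  with `S_q(a; h₁, h₂) = Σ_{x, y mod q, a x² ≡ y² (q)} e((x h₁ + y h₂)/q)` (`quadExpSum`), and the gcd
  `(z₁ h₁² - z₂ h₂², Δ)` of (8.5) (both coordinates) is `(h₁² - a h₂², Δ)` (`gcd_lambda_eq`).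
* **Multiplicativity** (`quadExpSum_mul_of_coprime`, the Chinese remainder theorem with the twist
  `e(T/mn) = e(vT/m) e(uT/n)`, `um + vn = 1`; "Since `N(a; q)` is multiplicative", (8.9)).
* **The local computation at `q = p^ν`, `p ∤ a`** (`norm_quadExpSum_prime_pow_le`:
  `|S_{p^ν}| ≤ (2ν + 3)(h₁² - a h₂², p^ν)`), which is the source's parametrisation
  `γ_i = d₁ d₂ η_i` read prime by prime: the pairs with `p^{⌈ν/2⌉} ∣ x` force `p^{⌈ν/2⌉} ∣ y` and
  contribute two geometric sums (`norm_zeroBlock_le`); the pairs with `p^k ∥ x`, `2k < ν`, force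
  `p^k ∥ y` and, with `x = p^k x₁`, `y = p^k y₁`, `μ = ν - 2k`, reduce to units `x₁, y₁ (mod p^{μ+k})`
  with `a x₁² ≡ y₁² (mod p^μ)` (`exactBlock_eq_blockSum`); splitting `x₁ = x₀ + p^μ s` separates two
  more geometric sums `Σ_s e(s h₁/p^k)` ("The innermost sum vanishes unless `h₁ ≡ h₂ ≡ 0 (mod d₂)`",
  `blockSum_eq`), and "changing `η₂` into `ω η₁`" (`sum_fibre_eq_sum_sqrtSet`) leaves a sum of at
  most four Ramanujan sums `c_{p^μ}(h₁' + ω h₂')`, `ω² ≡ a` (`coreSum_eq_sum_ramanujanSum`), each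
  bounded by `(h₁' + ω h₂', p^μ) ≤ (h₁'² - a h₂'², p^μ)` (`norm_ramanujanSum_prime_pow_le`,
  `norm_coreSum_le`, `norm_blockSum_le`).
* **Assembly** (`norm_quadExpSum_le`: `|S_q(a; h₁, h₂)| ≤ τ(q)⁴ (h₁² - a h₂², q)` for `(a, q) = 1`, by
  induction over the factorisation; `card_quadPairs_le`: the case `h₁ = h₂ = 0` counts the pairs).

## Contents

* reindexing: `sum_filter_dvd_range_mul`, `sum_filter_exactPow_range`, `sum_range_mul_shift`,
  `sum_range_eq_sum_dvd_add_sum_exactPow`, `sum_range_mul_coprime` (CRT bijection);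
* characters: `sum_filter_dvd_fourierChar`, `ramanujanSum_prime_pow`, `norm_ramanujanSum_prime_pow_le`
  (`|c_{p^μ}(h)| ≤ (h, p^μ)`), `fourierChar_mod_mul_div`, `fourierChar_add_div`, `fourierChar_crt`;
* `quadExpSum` and the local theory: `dvd_sub_sq_iff_of_dvd`, `norm_zeroBlock_le`,
  `exactPow_of_dvd_sub_sq`, `blockSum`, `exactBlock_eq_blockSum`, `coreSum`, `blockSum_eq`, `sqrtSet`,
  `card_sqrtSet_le_four`, `sum_fibre_eq_sum_sqrtSet`, `coreSum_eq_sum_ramanujanSum`, `norm_coreSum_le`,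
  `norm_blockSum_le`, `norm_quadExpSum_prime_pow_le`;
* global: `dvd_quadForm_mod_iff`, `quadExpSum_mul_of_coprime`, **`norm_quadExpSum_le`**,
  `card_quadPairs_le`;
* pairs `z₁, z₂ ∈ ℤ²`: `exists_ratio_mod_det`, `isCoprime_ratio`, `congrPair_iff_dvd`, `gExpSum`
  (`= |Δ| G(h₁, h₂)`), `gCount` (`= |Δ| G₀`), `gExpSum_eq_quadExpSum`, `gCount_eq`, `gcd_lambda_eq`,
  **`norm_gExpSum_le`** (Lemma 8.1), **`gCount_le`** ((8.6)).

## References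

* J. Friedlander, H. Iwaniec, Ann. of Math. (2) 148 (1998), 945–1040, §8, (8.1)–(8.9), Lemma 8.1;
  §6 (6.4)–(6.6), (6.10), (6.12). [FriedlanderIwaniecAnnals1998]

## Tree / Mathlib

Tree: `ramanujanSum`, `RamanujanSum.sum_range_fourierChar_div`, `RamanujanSum.fourierChar_intCast`
(`RamanujanSum`); `card_filter_unitSq_le_four`, `pow_dvd_of_pow_dvd_sq` (`…QuadCongr`); `det2`,
`CongrPair` (`…Lemma51`, `…LatticeCount`). Mathlib: `Real.fourierChar` (`𝐞`), `Nat.chineseRemainder`,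
`Nat.modEq_and_modEq_iff_modEq_mul`, `Nat.exists_mul_mod_eq_one_of_coprime`,
`Nat.recOnPosPrimePosCoprime`, `Nat.Coprime.card_divisors_mul`, `Nat.Coprime.gcd_mul`,
`Nat.Coprime.gcd_mul_left_cancel`, `IsCoprime.mul_dvd`, `IsCoprime.dvd_of_dvd_mul_right`.
-/

noncomputable section

open Finset
open scoped FourierTransform

namespace Literature.NumberTheory.Sieve.FriedlanderIwaniecPrimes

open RamanujanSum

/-! ### Reindexing lemmas for sums over `range` -/

/-- `Σ_{x < d n, d ∣ x} f(x) = Σ_{x' < n} f(d x')`. [folklore] -/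
theorem sum_filter_dvd_range_mul {M : Type*} [AddCommMonoid M] {d : ℕ} (hd : 0 < d) (n : ℕ)
    (f : ℕ → M) :
    ∑ x ∈ (range (d * n)).filter (fun x => d ∣ x), f x = ∑ x ∈ range n, f (d * x) := by
  have himg : (range (d * n)).filter (fun x => d ∣ x) = (range n).image (fun x => d * x) := by
    ext x
    simp only [mem_filter, mem_range, mem_image]
    constructor
    · rintro ⟨hx, ⟨k, rfl⟩⟩
      exact ⟨k, (Nat.lt_of_mul_lt_mul_left hx), rfl⟩
    · rintro ⟨k, hk, rfl⟩
      exact ⟨Nat.mul_lt_mul_of_pos_left hk hd, dvd_mul_right _ _⟩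
  rw [himg, sum_image]
  intro x _ y _ h
  exact Nat.eq_of_mul_eq_mul_left hd h

/-- `Σ_{x < p^k n, p^k ∥ x} f(x) = Σ_{x' < n, p ∤ x'} f(p^k x')`. [folklore] -/
theorem sum_filter_exactPow_range {M : Type*} [AddCommMonoid M] {p : ℕ} (hp : p.Prime) (k n : ℕ)
    (f : ℕ → M) :
    ∑ x ∈ (range (p ^ k * n)).filter (fun x => p ^ k ∣ x ∧ ¬ p ^ (k + 1) ∣ x), f x =
      ∑ x ∈ (range n).filter (fun x => ¬ p ∣ x), f (p ^ k * x) := by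
  have hpk : 0 < p ^ k := pow_pos hp.pos k
  rw [← filter_filter, sum_filter, sum_filter_dvd_range_mul hpk, ← sum_filter]
  congr 1
  ext x
  simp only [mem_filter, mem_range, and_congr_right_iff]
  intro _
  rw [pow_succ, Nat.mul_dvd_mul_iff_left hpk]

/-- Splitting `x < m n` as `x = x₀ + m s`, `x₀ < m`, `s < n`. [folklore] -/
theorem sum_range_mul_shift {M : Type*} [AddCommMonoid M] (m n : ℕ) (f : ℕ → M) :
    ∑ x ∈ range (m * n), f x = ∑ s ∈ range n, ∑ x₀ ∈ range m, f (x₀ + m * s) := by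
  induction n with
  | zero => simp
  | succ n ih =>
    rw [Nat.mul_succ, range_add, sum_union (disjoint_range_addLeftEmbedding _ _), ih,
      sum_range_succ, sum_map]
    congr 1
    refine sum_congr rfl fun x _ => ?_
    simp only [addLeftEmbedding_apply]
    rw [add_comm]

/-- Partition of `x < q` by the exact power of `p` dividing `x`, truncated at `m`:
`Σ_{x<q} F x = Σ_{x<q, p^m ∣ x} F x + Σ_{k<m} Σ_{x<q, p^k ∥ x} F x`. [folklore] -/
theorem sum_range_eq_sum_dvd_add_sum_exactPow {M : Type*} [AddCommMonoid M] (p q m : ℕ)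
    (F : ℕ → M) :
    ∑ x ∈ range q, F x = ∑ x ∈ (range q).filter (fun x => p ^ m ∣ x), F x +
      ∑ k ∈ range m, ∑ x ∈ (range q).filter (fun x => p ^ k ∣ x ∧ ¬ p ^ (k + 1) ∣ x), F x := by
  induction m with
  | zero => simp
  | succ m ih =>
    rw [ih, sum_range_succ, ← add_assoc, add_right_comm]
    congr 1
    rw [← sum_filter_add_sum_filter_not ((range q).filter fun x => p ^ m ∣ x) (fun x => p ^ (m + 1) ∣ x),
      filter_filter, filter_filter]
    congr 2
    ext x
    simp only [mem_filter, mem_range, and_congr_right_iff]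
    intro _
    constructor
    · rintro ⟨-, h⟩; exact h
    · intro h; exact ⟨(pow_dvd_pow p (Nat.le_succ m)).trans h, h⟩

/-! ### Geometric sums and Ramanujan sums at prime powers -/

/-- `Σ_{x < q, d ∣ x} e(x h / q) = (q/d) [q/d ∣ h]` for `q = d n`:
precisely `Σ_{x < d n, d ∣ x} e(x h/(d n)) = n [n ∣ h]`. [folklore] -/
theorem sum_filter_dvd_fourierChar {d n : ℕ} (hd : 0 < d) (hn : 0 < n) (h : ℤ) :
    ∑ x ∈ (range (d * n)).filter (fun x => d ∣ x), (𝐞 ((x : ℝ) * h / (d * n : ℕ)) : ℂ) =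
      if (n : ℤ) ∣ h then (n : ℂ) else 0 := by
  rw [sum_filter_dvd_range_mul hd, ← sum_range_fourierChar_div hn.ne' h]
  refine sum_congr rfl fun x _ => ?_
  congr 2
  have hd' : (d : ℝ) ≠ 0 := by exact_mod_cast hd.ne'
  push_cast
  field_simp

/-- The Ramanujan sum at a prime power as a difference of two geometric sums:
`c_{p^μ}(h) = p^μ [p^μ ∣ h] - p^{μ-1} [p^{μ-1} ∣ h]` (`μ ≥ 1`). [folklore] -/
theorem ramanujanSum_prime_pow {p : ℕ} (hp : p.Prime) {μ : ℕ} (hμ : 0 < μ) (h : ℤ) :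
    ramanujanSum (p ^ μ) h = (if ((p ^ μ : ℕ) : ℤ) ∣ h then ((p ^ μ : ℕ) : ℂ) else 0) -
      (if ((p ^ (μ - 1) : ℕ) : ℤ) ∣ h then ((p ^ (μ - 1) : ℕ) : ℂ) else 0) := by
  have hq : p ^ μ = p * p ^ (μ - 1) := by rw [← pow_succ']; congr 1; omega
  have hsplit := sum_filter_add_sum_filter_not (range (p ^ μ)) (fun x : ℕ => x.Coprime (p ^ μ))
    (fun x : ℕ => (𝐞 ((x : ℝ) * h / (p ^ μ : ℕ)) : ℂ))
  have hcop : ∀ x : ℕ, ¬ x.Coprime (p ^ μ) ↔ p ∣ x := by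
    intro x
    rw [Nat.coprime_pow_right_iff hμ, Nat.coprime_comm, hp.coprime_iff_not_dvd, not_not]
  have h1 : ∑ x ∈ (range (p ^ μ)).filter (fun x : ℕ => ¬ x.Coprime (p ^ μ)),
      (𝐞 ((x : ℝ) * h / (p ^ μ : ℕ)) : ℂ) =
      if ((p ^ (μ - 1) : ℕ) : ℤ) ∣ h then ((p ^ (μ - 1) : ℕ) : ℂ) else 0 := by
    rw [filter_congr fun x _ => hcop x]
    conv_lhs => rw [hq]
    exact sum_filter_dvd_fourierChar hp.pos (pow_pos hp.pos _) h
  have h2 := sum_range_fourierChar_div (pow_ne_zero μ hp.ne_zero) h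
  rw [ramanujanSum, ← h2, ← hsplit, h1]
  ring

/-- `|c_{p^μ}(h)| ≤ (h, p^μ)`. [folklore] -/
theorem norm_ramanujanSum_prime_pow_le {p : ℕ} (hp : p.Prime) (μ : ℕ) (h : ℤ) :
    ‖ramanujanSum (p ^ μ) h‖ ≤ Nat.gcd h.natAbs (p ^ μ) := by
  rcases Nat.eq_zero_or_pos μ with rfl | hμ
  · simp
  rw [ramanujanSum_prime_pow hp hμ]
  have hg0 : 0 < Nat.gcd h.natAbs (p ^ μ) := Nat.gcd_pos_of_pos_right _ (pow_pos hp.pos _)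
  have key : ∀ j : ℕ, j ≤ μ → ((p ^ j : ℕ) : ℤ) ∣ h → (p ^ j : ℝ) ≤ Nat.gcd h.natAbs (p ^ μ) := by
    intro j hj hdvd
    have h1 : p ^ j ∣ Nat.gcd h.natAbs (p ^ μ) :=
      Nat.dvd_gcd (Int.natCast_dvd.mp hdvd) (pow_dvd_pow p hj)
    exact_mod_cast Nat.le_of_dvd hg0 h1
  by_cases h1 : ((p ^ μ : ℕ) : ℤ) ∣ h
  · have h2 : ((p ^ (μ - 1) : ℕ) : ℤ) ∣ h :=
      (Int.natCast_dvd_natCast.mpr (pow_dvd_pow p (Nat.sub_le μ 1))).trans h1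
    rw [if_pos h1, if_pos h2]
    have hle : (p ^ (μ - 1) : ℝ) ≤ p ^ μ := pow_le_pow_right₀ (by exact_mod_cast hp.one_lt.le) (Nat.sub_le μ 1)
    have e : ‖((p ^ μ : ℕ) : ℂ) - ((p ^ (μ - 1) : ℕ) : ℂ)‖ = (p ^ μ : ℝ) - p ^ (μ - 1) := by
      rw [show ((p ^ μ : ℕ) : ℂ) - ((p ^ (μ - 1) : ℕ) : ℂ) = (((p ^ μ : ℝ) - p ^ (μ - 1) : ℝ) : ℂ) by
        push_cast; ring, Complex.norm_real, Real.norm_eq_abs, abs_of_nonneg (by linarith)]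
    rw [e]
    have := key μ le_rfl h1
    have h0 : (0 : ℝ) ≤ p ^ (μ - 1) := by positivity
    linarith
  · rw [if_neg h1, zero_sub, norm_neg]
    by_cases h2 : ((p ^ (μ - 1) : ℕ) : ℤ) ∣ h
    · rw [if_pos h2]
      have e : ‖((p ^ (μ - 1) : ℕ) : ℂ)‖ = (p ^ (μ - 1) : ℝ) := by
        rw [show ((p ^ (μ - 1) : ℕ) : ℂ) = ((p ^ (μ - 1) : ℝ) : ℂ) by push_cast; ring,
          Complex.norm_real, Real.norm_eq_abs, abs_of_nonneg (by positivity)]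
      rw [e]
      exact key (μ - 1) (Nat.sub_le μ 1) h2
    · rw [if_neg h2, norm_zero]; positivity


/-- `e` is `1`-periodic in the numerator: `e((x mod q) h / q) = e(x h / q)`. [folklore] -/
theorem fourierChar_mod_mul_div (x q : ℕ) (h : ℤ) :
    (𝐞 (((x % q : ℕ) : ℝ) * h / q) : ℂ) = 𝐞 ((x : ℝ) * h / q) := by
  rcases Nat.eq_zero_or_pos q with rfl | hq
  · simp
  have hq' : (q : ℝ) ≠ 0 := by exact_mod_cast hq.ne'
  set k := x / q with hk
  have hx : ((x % q : ℕ) : ℝ) = x - q * k := by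
    have := Nat.mod_add_div x q
    have e : ((x % q : ℕ) : ℝ) + q * k = x := by rw [hk]; exact_mod_cast this
    linarith
  have e1 : ((x % q : ℕ) : ℝ) * h / q = (x : ℝ) * h / q + ((-(k : ℤ) * h : ℤ) : ℝ) := by
    rw [hx]; push_cast; field_simp; ring
  rw [e1, AddChar.map_add_eq_mul, Circle.coe_mul, fourierChar_intCast, mul_one]

/-- `e((a + b)/q) = e(a/q) e(b/q)`. [folklore] -/
theorem fourierChar_add_div (a b q : ℝ) : (𝐞 ((a + b) / q) : ℂ) = 𝐞 (a / q) * 𝐞 (b / q) := by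
  rw [add_div, AddChar.map_add_eq_mul, Circle.coe_mul]

/-! ### The exponential sum over pairs of roots of `a γ₁² ≡ γ₂²` -/

/-- `S_q(a; h₁, h₂) = Σ_{γ₁, γ₂ mod q, a γ₁² ≡ γ₂² (mod q)} e((γ₁ h₁ + γ₂ h₂)/q)` — the complete
exponential sum over the solutions of the binary quadratic congruence (8.8); `|Δ| G(h₁, h₂)` of
(6.10) is such a sum (`gExpSum_eq_quadExpSum` in the sequel).
[cite: FriedlanderIwaniecAnnals1998, (6.10) with (8.8)] -/
def quadExpSum (q : ℕ) (a h₁ h₂ : ℤ) : ℂ :=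
  ∑ x ∈ range q, ∑ y ∈ range q,
    if (q : ℤ) ∣ a * (x : ℤ) ^ 2 - (y : ℤ) ^ 2 then (𝐞 (((x : ℝ) * h₁ + (y : ℝ) * h₂) / q) : ℂ) else 0

/-- `quadExpSum` unfolded. [cite: FriedlanderIwaniecAnnals1998, (6.10)] -/
theorem quadExpSum_def (q : ℕ) (a h₁ h₂ : ℤ) : quadExpSum q a h₁ h₂ =
    ∑ x ∈ range q, ∑ y ∈ range q,
      if (q : ℤ) ∣ a * (x : ℤ) ^ 2 - (y : ℤ) ^ 2 then (𝐞 (((x : ℝ) * h₁ + (y : ℝ) * h₂) / q) : ℂ)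
      else 0 := rfl

/-- `S_1 = 1`. [folklore] -/
theorem quadExpSum_one (a h₁ h₂ : ℤ) : quadExpSum 1 a h₁ h₂ = 1 := by
  simp [quadExpSum]

/-- The trivial bound `|S_q| ≤ q²`. [folklore] -/
theorem norm_quadExpSum_le_sq (q : ℕ) (a h₁ h₂ : ℤ) : ‖quadExpSum q a h₁ h₂‖ ≤ (q : ℝ) ^ 2 := by
  unfold quadExpSum
  refine (norm_sum_le _ _).trans ?_
  have h1 : ∀ x ∈ range q, ‖∑ y ∈ range q,
      (if (q : ℤ) ∣ a * (x : ℤ) ^ 2 - (y : ℤ) ^ 2 then (𝐞 (((x : ℝ) * h₁ + (y : ℝ) * h₂) / q) : ℂ)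
        else 0)‖ ≤ q := by
    intro x _
    refine (norm_sum_le _ _).trans ?_
    have : ∀ y ∈ range q, ‖(if (q : ℤ) ∣ a * (x : ℤ) ^ 2 - (y : ℤ) ^ 2 then
        (𝐞 (((x : ℝ) * h₁ + (y : ℝ) * h₂) / q) : ℂ) else 0)‖ ≤ 1 := by
      intro y _
      split_ifs
      · rw [Circle.norm_coe]
      · rw [norm_zero]; exact zero_le_one
    refine (sum_le_sum this).trans ?_
    simp
  refine (sum_le_sum h1).trans ?_
  simp [sq]

/-! ### The local bound at a prime power -/

section Local

variable {p : ℕ} (hp : p.Prime)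
include hp

/-- The zero block: for `p^m ∣ x` with `2m ≥ ν`, `p^ν ∣ a x² - y² ↔ p^m ∣ y` where `m = ⌈ν/2⌉`. [folklore] -/
theorem dvd_sub_sq_iff_of_dvd {ν x y : ℕ} (a : ℤ) (hx : p ^ (ν - ν / 2) ∣ x) :
    ((p ^ ν : ℕ) : ℤ) ∣ a * (x : ℤ) ^ 2 - (y : ℤ) ^ 2 ↔ p ^ (ν - ν / 2) ∣ y := by
  have hx2 : ((p ^ ν : ℕ) : ℤ) ∣ a * (x : ℤ) ^ 2 := by
    refine Dvd.dvd.mul_left ?_ a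
    have h1 : p ^ ν ∣ x ^ 2 := by
      obtain ⟨t, rfl⟩ := hx
      rw [mul_pow, ← pow_mul]
      exact Dvd.dvd.mul_right (pow_dvd_pow p (by omega)) _
    exact_mod_cast h1
  constructor
  · intro h
    have hy2 : ((p ^ ν : ℕ) : ℤ) ∣ (y : ℤ) ^ 2 := by
      have := dvd_sub hx2 h
      rwa [sub_sub_cancel] at this
    have hy2' : p ^ ν ∣ y ^ 2 := by exact_mod_cast hy2
    have := pow_dvd_of_pow_dvd_sq hp hy2'
    have hm : ν - ν / 2 = (ν + 1) / 2 := by omega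
    rwa [hm]
  · intro hy
    refine dvd_sub hx2 ?_
    have h1 : p ^ ν ∣ y ^ 2 := by
      obtain ⟨t, rfl⟩ := hy
      rw [mul_pow, ← pow_mul]
      exact Dvd.dvd.mul_right (pow_dvd_pow p (by omega)) _
    exact_mod_cast h1

/-- **The zero block**: `|Σ_{x < p^ν, p^m ∣ x} Σ_y [p^ν ∣ a x² - y²] e((x h₁ + y h₂)/p^ν)| ≤ (h₁² - a h₂², p^ν)`
(`m = ⌈ν/2⌉`; the sum equals `p^{2⌊ν/2⌋} [p^{⌊ν/2⌋} ∣ h₁] [p^{⌊ν/2⌋} ∣ h₂]`). [folklore] -/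
theorem norm_zeroBlock_le (ν : ℕ) (a h₁ h₂ : ℤ) :
    ‖∑ x ∈ (range (p ^ ν)).filter (fun x => p ^ (ν - ν / 2) ∣ x), ∑ y ∈ range (p ^ ν),
      (if ((p ^ ν : ℕ) : ℤ) ∣ a * (x : ℤ) ^ 2 - (y : ℤ) ^ 2 then
        (𝐞 (((x : ℝ) * h₁ + (y : ℝ) * h₂) / (p ^ ν : ℕ)) : ℂ) else 0)‖ ≤
      Nat.gcd (h₁ ^ 2 - a * h₂ ^ 2).natAbs (p ^ ν) := by
  set m := ν - ν / 2 with hm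
  set n := ν / 2 with hn
  have hq : p ^ ν = p ^ m * p ^ n := by rw [← pow_add]; congr 1; omega
  have hpm : 0 < p ^ m := pow_pos hp.pos m
  have hpn : 0 < p ^ n := pow_pos hp.pos n
  -- rewrite the inner sums
  have hinner : ∀ x ∈ (range (p ^ ν)).filter (fun x => p ^ m ∣ x),
      (∑ y ∈ range (p ^ ν), (if ((p ^ ν : ℕ) : ℤ) ∣ a * (x : ℤ) ^ 2 - (y : ℤ) ^ 2 then
        (𝐞 (((x : ℝ) * h₁ + (y : ℝ) * h₂) / (p ^ ν : ℕ)) : ℂ) else 0)) =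
      (𝐞 ((x : ℝ) * h₁ / (p ^ ν : ℕ)) : ℂ) *
        ∑ y ∈ (range (p ^ ν)).filter (fun y => p ^ m ∣ y), (𝐞 ((y : ℝ) * h₂ / (p ^ ν : ℕ)) : ℂ) := by
    intro x hx
    have hxd : p ^ m ∣ x := (mem_filter.mp hx).2
    rw [sum_filter, mul_sum]
    refine sum_congr rfl fun y _ => ?_
    by_cases hy : p ^ m ∣ y
    · rw [if_pos ((dvd_sub_sq_iff_of_dvd hp a hxd).mpr hy), if_pos hy, fourierChar_add_div]
    · rw [if_neg (fun h => hy ((dvd_sub_sq_iff_of_dvd hp a hxd).mp h)), if_neg hy, mul_zero]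
  rw [sum_congr rfl hinner, ← sum_mul]
  have hA : ∑ x ∈ (range (p ^ ν)).filter (fun x => p ^ m ∣ x), (𝐞 ((x : ℝ) * h₁ / (p ^ ν : ℕ)) : ℂ) =
      if ((p ^ n : ℕ) : ℤ) ∣ h₁ then ((p ^ n : ℕ) : ℂ) else 0 := by
    rw [hq]; exact sum_filter_dvd_fourierChar hpm hpn h₁
  have hB : ∑ y ∈ (range (p ^ ν)).filter (fun y => p ^ m ∣ y), (𝐞 ((y : ℝ) * h₂ / (p ^ ν : ℕ)) : ℂ) =
      if ((p ^ n : ℕ) : ℤ) ∣ h₂ then ((p ^ n : ℕ) : ℂ) else 0 := by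
    rw [hq]; exact sum_filter_dvd_fourierChar hpm hpn h₂
  rw [hA, hB]
  have hg0 : 0 < Nat.gcd (h₁ ^ 2 - a * h₂ ^ 2).natAbs (p ^ ν) := Nat.gcd_pos_of_pos_right _ (pow_pos hp.pos ν)
  by_cases hd1 : ((p ^ n : ℕ) : ℤ) ∣ h₁
  · by_cases hd2 : ((p ^ n : ℕ) : ℤ) ∣ h₂
    · rw [if_pos hd1, if_pos hd2, norm_mul, Complex.norm_natCast, ← Nat.cast_mul, ← pow_add]
      have hdvd : p ^ (n + n) ∣ Nat.gcd (h₁ ^ 2 - a * h₂ ^ 2).natAbs (p ^ ν) := by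
        refine Nat.dvd_gcd ?_ (pow_dvd_pow p (by omega))
        have h1 : ((p ^ (n + n) : ℕ) : ℤ) ∣ h₁ ^ 2 - a * h₂ ^ 2 := by
          refine dvd_sub ?_ (Dvd.dvd.mul_left ?_ a)
          · obtain ⟨t, rfl⟩ := hd1
            exact ⟨t ^ 2, by push_cast; ring⟩
          · obtain ⟨t, rfl⟩ := hd2
            exact ⟨t ^ 2, by push_cast; ring⟩
        exact Int.natCast_dvd.mp h1
      exact_mod_cast Nat.le_of_dvd hg0 hdvd
    · rw [if_neg hd2, mul_zero, norm_zero]; positivity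
  · rw [if_neg hd1, zero_mul, norm_zero]; positivity

/-- In an exact block `p^k ∥ x` with `2k < ν`, a solution `y` of `p^ν ∣ a x² - y²` (`p ∤ a`) has
`p^k ∥ y`. [folklore] -/
theorem exactPow_of_dvd_sub_sq {ν k x₁ y : ℕ} {a : ℤ} (ha : ¬ (p : ℤ) ∣ a) (hk : 2 * k < ν)
    (hx₁ : ¬ p ∣ x₁) (h : ((p ^ ν : ℕ) : ℤ) ∣ a * ((p ^ k * x₁ : ℕ) : ℤ) ^ 2 - (y : ℤ) ^ 2) :
    p ^ k ∣ y ∧ ¬ p ^ (k + 1) ∣ y := by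
  have hpp : Prime (p : ℤ) := Nat.prime_iff_prime_int.mp hp
  have h2k : ((p ^ (2 * k) : ℕ) : ℤ) ∣ a * ((p ^ k * x₁ : ℕ) : ℤ) ^ 2 :=
    ⟨a * (x₁ : ℤ) ^ 2, by push_cast; ring⟩
  constructor
  · have h1 : ((p ^ (2 * k) : ℕ) : ℤ) ∣ (y : ℤ) ^ 2 := by
      have h' := (Int.natCast_dvd_natCast.mpr (pow_dvd_pow p hk.le)).trans h
      have := dvd_sub h2k h'
      rwa [sub_sub_cancel] at this
    have h1' : p ^ (2 * k) ∣ y ^ 2 := by exact_mod_cast h1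
    have := pow_dvd_of_pow_dvd_sq hp h1'
    rwa [show (2 * k + 1) / 2 = k by omega] at this
  · intro hy
    have h1 : ((p ^ (2 * k + 1) : ℕ) : ℤ) ∣ (y : ℤ) ^ 2 := by
      obtain ⟨t, rfl⟩ := hy
      refine ⟨(p : ℤ) * t ^ 2, ?_⟩
      push_cast; ring
    have h2 : ((p ^ (2 * k + 1) : ℕ) : ℤ) ∣ a * ((p ^ k * x₁ : ℕ) : ℤ) ^ 2 := by
      have h' := (Int.natCast_dvd_natCast.mpr (pow_dvd_pow p (by omega : 2 * k + 1 ≤ ν))).trans h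
      have := dvd_add h' h1
      rwa [sub_add_cancel] at this
    have h3 : (p : ℤ) ∣ a * (x₁ : ℤ) ^ 2 := by
      have e : a * ((p ^ k * x₁ : ℕ) : ℤ) ^ 2 = ((p ^ (2 * k) : ℕ) : ℤ) * (a * (x₁ : ℤ) ^ 2) := by
        push_cast; ring
      rw [e, pow_succ, Nat.cast_mul] at h2
      exact (mul_dvd_mul_iff_left (by exact_mod_cast (pow_pos hp.pos _).ne')).mp h2
    rcases hpp.dvd_or_dvd h3 with h4 | h4
    · exact ha h4
    · exact hx₁ (Int.natCast_dvd_natCast.mp (hpp.dvd_of_dvd_pow h4))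

/-- The reduced sum of an exact block: `Σ_{x₁, y₁ < p^μ p^k, p ∤ x₁ y₁, p^μ ∣ a x₁² - y₁²}
e((x₁ h₁ + y₁ h₂)/(p^μ p^k))`. [folklore] -/
def blockSum (p μ k : ℕ) (a h₁ h₂ : ℤ) : ℂ :=
  ∑ x₁ ∈ (range (p ^ μ * p ^ k)).filter (fun x => ¬ p ∣ x),
    ∑ y₁ ∈ (range (p ^ μ * p ^ k)).filter (fun y => ¬ p ∣ y),
      if ((p ^ μ : ℕ) : ℤ) ∣ a * (x₁ : ℤ) ^ 2 - (y₁ : ℤ) ^ 2 then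
        (𝐞 (((x₁ : ℝ) * h₁ + (y₁ : ℝ) * h₂) / (p ^ μ * p ^ k : ℕ)) : ℂ) else 0

/-- **An exact block reduces**: for `2k < ν`, `μ = ν - 2k`,
`Σ_{x < p^ν, p^k ∥ x} Σ_{y < p^ν} [p^ν ∣ a x² - y²] e((x h₁ + y h₂)/p^ν) = blockSum p μ k a h₁ h₂`
(`x = p^k x₁`, `y = p^k y₁`). [folklore] -/
theorem exactBlock_eq_blockSum {ν k : ℕ} (hk : 2 * k < ν) {a : ℤ} (ha : ¬ (p : ℤ) ∣ a) (h₁ h₂ : ℤ) :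
    ∑ x ∈ (range (p ^ ν)).filter (fun x => p ^ k ∣ x ∧ ¬ p ^ (k + 1) ∣ x), ∑ y ∈ range (p ^ ν),
      (if ((p ^ ν : ℕ) : ℤ) ∣ a * (x : ℤ) ^ 2 - (y : ℤ) ^ 2 then
        (𝐞 (((x : ℝ) * h₁ + (y : ℝ) * h₂) / (p ^ ν : ℕ)) : ℂ) else 0) =
      blockSum p (ν - 2 * k) k a h₁ h₂ := by
  set μ := ν - 2 * k with hμ
  have hν : p ^ ν = p ^ k * (p ^ μ * p ^ k) := by
    rw [← pow_add, ← pow_add]; congr 1; omega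
  have hν' : ((p ^ ν : ℕ) : ℤ) = ((p ^ (2 * k) : ℕ) : ℤ) * ((p ^ μ : ℕ) : ℤ) := by
    rw [← Nat.cast_mul, ← pow_add]; congr 2; omega
  have hp2k : ((p ^ (2 * k) : ℕ) : ℤ) ≠ 0 := by exact_mod_cast (pow_pos hp.pos _).ne'
  have hpk0 : (p ^ k : ℝ) ≠ 0 := by exact_mod_cast (pow_pos hp.pos k).ne'
  conv_lhs => rw [hν]
  rw [sum_filter_exactPow_range hp k (p ^ μ * p ^ k)]
  unfold blockSum
  refine sum_congr rfl fun x₁ hx₁ => ?_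
  have hx₁' : ¬ p ∣ x₁ := (mem_filter.mp hx₁).2
  -- restrict the `y`-sum to the exact block `p^k ∥ y`, then reindex
  rw [← hν]
  have hrestrict : ∑ y ∈ range (p ^ ν),
      (if ((p ^ ν : ℕ) : ℤ) ∣ a * ((p ^ k * x₁ : ℕ) : ℤ) ^ 2 - (y : ℤ) ^ 2 then
        (𝐞 ((((p ^ k * x₁ : ℕ) : ℝ) * h₁ + (y : ℝ) * h₂) / (p ^ ν : ℕ)) : ℂ) else 0) =
      ∑ y ∈ (range (p ^ ν)).filter (fun y => p ^ k ∣ y ∧ ¬ p ^ (k + 1) ∣ y),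
      (if ((p ^ ν : ℕ) : ℤ) ∣ a * ((p ^ k * x₁ : ℕ) : ℤ) ^ 2 - (y : ℤ) ^ 2 then
        (𝐞 ((((p ^ k * x₁ : ℕ) : ℝ) * h₁ + (y : ℝ) * h₂) / (p ^ ν : ℕ)) : ℂ) else 0) := by
    rw [sum_filter]
    refine sum_congr rfl fun y _ => ?_
    by_cases hc : ((p ^ ν : ℕ) : ℤ) ∣ a * ((p ^ k * x₁ : ℕ) : ℤ) ^ 2 - (y : ℤ) ^ 2
    · rw [if_pos (exactPow_of_dvd_sub_sq hp ha hk hx₁' hc)]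
    · rw [if_neg hc]; split_ifs <;> rfl
  rw [hrestrict]
  conv_lhs => rw [hν]
  rw [sum_filter_exactPow_range hp k (p ^ μ * p ^ k), ← hν]
  refine sum_congr rfl fun y₁ _ => ?_
  -- the condition and the phase
  have hcond : ((p ^ ν : ℕ) : ℤ) ∣ a * ((p ^ k * x₁ : ℕ) : ℤ) ^ 2 - ((p ^ k * y₁ : ℕ) : ℤ) ^ 2 ↔
      ((p ^ μ : ℕ) : ℤ) ∣ a * (x₁ : ℤ) ^ 2 - (y₁ : ℤ) ^ 2 := by
    have e : a * ((p ^ k * x₁ : ℕ) : ℤ) ^ 2 - ((p ^ k * y₁ : ℕ) : ℤ) ^ 2 =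
        ((p ^ (2 * k) : ℕ) : ℤ) * (a * (x₁ : ℤ) ^ 2 - (y₁ : ℤ) ^ 2) := by push_cast; ring
    rw [e, hν']
    exact mul_dvd_mul_iff_left hp2k
  have hphase : (((p ^ k * x₁ : ℕ) : ℝ) * h₁ + ((p ^ k * y₁ : ℕ) : ℝ) * h₂) / (p ^ ν : ℕ) =
      ((x₁ : ℝ) * h₁ + (y₁ : ℝ) * h₂) / (p ^ μ * p ^ k : ℕ) := by
    rw [hν]; push_cast; field_simp
  by_cases hc : ((p ^ μ : ℕ) : ℤ) ∣ a * (x₁ : ℤ) ^ 2 - (y₁ : ℤ) ^ 2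
  · rw [if_pos (hcond.mpr hc), if_pos hc, hphase]
  · rw [if_neg (fun h => hc (hcond.mp h)), if_neg hc]

/-- The core of a block after the shifts are split off:
`Σ_{x₀, y₀ < p^μ, p ∤ x₀ y₀, p^μ ∣ a x₀² - y₀²} e(x₀ h₁/(p^μ p^k)) e(y₀ h₂/(p^μ p^k))`. [folklore] -/
def coreSum (p μ k : ℕ) (a h₁ h₂ : ℤ) : ℂ :=
  ∑ x₀ ∈ (range (p ^ μ)).filter (fun x => ¬ p ∣ x), ∑ y₀ ∈ (range (p ^ μ)).filter (fun y => ¬ p ∣ y),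
    if ((p ^ μ : ℕ) : ℤ) ∣ a * (x₀ : ℤ) ^ 2 - (y₀ : ℤ) ^ 2 then
      (𝐞 ((x₀ : ℝ) * h₁ / (p ^ μ * p ^ k : ℕ)) : ℂ) * 𝐞 ((y₀ : ℝ) * h₂ / (p ^ μ * p ^ k : ℕ)) else 0

/-- **Splitting off the shifts** `x₁ = x₀ + p^μ s`, `y₁ = y₀ + p^μ t` (`μ ≥ 1`):
`blockSum = (Σ_{s<p^k} e(s h₁/p^k)) (Σ_{t<p^k} e(t h₂/p^k)) · coreSum`. [folklore] -/
theorem blockSum_eq {μ : ℕ} (hμ : 0 < μ) (k : ℕ) (a h₁ h₂ : ℤ) :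
    blockSum p μ k a h₁ h₂ =
      (∑ s ∈ range (p ^ k), (𝐞 ((s : ℝ) * h₁ / (p ^ k : ℕ)) : ℂ)) *
        (∑ t ∈ range (p ^ k), (𝐞 ((t : ℝ) * h₂ / (p ^ k : ℕ)) : ℂ)) * coreSum p μ k a h₁ h₂ := by
  have hpμ : 0 < p ^ μ := pow_pos hp.pos μ
  have hpk : (0 : ℝ) < p ^ k := by exact_mod_cast pow_pos hp.pos k
  have hpμr : (0 : ℝ) < p ^ μ := by exact_mod_cast hpμ
  have hpd : p ∣ p ^ μ := dvd_pow_self p hμ.ne'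
  -- the summand as a function on `ℕ × ℕ` with indicator factors
  set Φ : ℕ → ℕ → ℂ := fun x y => if ¬ p ∣ x then (if ¬ p ∣ y then
      (if ((p ^ μ : ℕ) : ℤ) ∣ a * (x : ℤ) ^ 2 - (y : ℤ) ^ 2 then
        (𝐞 (((x : ℝ) * h₁ + (y : ℝ) * h₂) / (p ^ μ * p ^ k : ℕ)) : ℂ) else 0) else 0) else 0 with hΦ
  have h1 : blockSum p μ k a h₁ h₂ = ∑ x ∈ range (p ^ μ * p ^ k), ∑ y ∈ range (p ^ μ * p ^ k), Φ x y := by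
    unfold blockSum
    rw [sum_filter]
    refine sum_congr rfl fun x _ => ?_
    by_cases hx : ¬ p ∣ x
    · rw [if_pos hx, sum_filter]
      refine sum_congr rfl fun y _ => ?_
      rw [hΦ]; dsimp only; rw [if_pos hx]
    · rw [if_neg hx]
      refine (sum_eq_zero fun y _ => ?_).symm
      rw [hΦ]; dsimp only; rw [if_neg hx]
  -- the core summand
  set Ψ : ℕ → ℕ → ℂ := fun x y => if ¬ p ∣ x then (if ¬ p ∣ y then
      (if ((p ^ μ : ℕ) : ℤ) ∣ a * (x : ℤ) ^ 2 - (y : ℤ) ^ 2 then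
        (𝐞 ((x : ℝ) * h₁ / (p ^ μ * p ^ k : ℕ)) : ℂ) * 𝐞 ((y : ℝ) * h₂ / (p ^ μ * p ^ k : ℕ)) else 0)
      else 0) else 0 with hΨ
  have h2 : coreSum p μ k a h₁ h₂ = ∑ x ∈ range (p ^ μ), ∑ y ∈ range (p ^ μ), Ψ x y := by
    unfold coreSum
    rw [sum_filter]
    refine sum_congr rfl fun x _ => ?_
    by_cases hx : ¬ p ∣ x
    · rw [if_pos hx, sum_filter]
      refine sum_congr rfl fun y _ => ?_
      rw [hΨ]; dsimp only; rw [if_pos hx]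
    · rw [if_neg hx]
      refine (sum_eq_zero fun y _ => ?_).symm
      rw [hΨ]; dsimp only; rw [if_neg hx]
  -- pointwise factorisation after the shift
  have hpt : ∀ x₀ s y₀ t : ℕ, Φ (x₀ + p ^ μ * s) (y₀ + p ^ μ * t) =
      Ψ x₀ y₀ * ((𝐞 ((s : ℝ) * h₁ / (p ^ k : ℕ)) : ℂ) * 𝐞 ((t : ℝ) * h₂ / (p ^ k : ℕ))) := by
    intro x₀ s y₀ t
    have ex : ¬ p ∣ x₀ + p ^ μ * s ↔ ¬ p ∣ x₀ := by rw [Nat.dvd_add_left (Dvd.dvd.mul_right hpd s)]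
    have ey : ¬ p ∣ y₀ + p ^ μ * t ↔ ¬ p ∣ y₀ := by rw [Nat.dvd_add_left (Dvd.dvd.mul_right hpd t)]
    have ec : ((p ^ μ : ℕ) : ℤ) ∣ a * ((x₀ + p ^ μ * s : ℕ) : ℤ) ^ 2 - ((y₀ + p ^ μ * t : ℕ) : ℤ) ^ 2 ↔
        ((p ^ μ : ℕ) : ℤ) ∣ a * (x₀ : ℤ) ^ 2 - (y₀ : ℤ) ^ 2 := by
      have e : a * ((x₀ + p ^ μ * s : ℕ) : ℤ) ^ 2 - ((y₀ + p ^ μ * t : ℕ) : ℤ) ^ 2 =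
          (a * (x₀ : ℤ) ^ 2 - (y₀ : ℤ) ^ 2) + ((p ^ μ : ℕ) : ℤ) *
            (a * (2 * (x₀ : ℤ) * s + (p ^ μ : ℕ) * (s : ℤ) ^ 2) - (2 * (y₀ : ℤ) * t + (p ^ μ : ℕ) * (t : ℤ) ^ 2)) := by
        push_cast; ring
      rw [e, dvd_add_left (dvd_mul_right _ _)]
    have eph : (𝐞 ((((x₀ + p ^ μ * s : ℕ) : ℝ) * h₁ + ((y₀ + p ^ μ * t : ℕ) : ℝ) * h₂) / (p ^ μ * p ^ k : ℕ)) : ℂ) =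
        (𝐞 ((x₀ : ℝ) * h₁ / (p ^ μ * p ^ k : ℕ)) : ℂ) * 𝐞 ((y₀ : ℝ) * h₂ / (p ^ μ * p ^ k : ℕ)) *
          ((𝐞 ((s : ℝ) * h₁ / (p ^ k : ℕ)) : ℂ) * 𝐞 ((t : ℝ) * h₂ / (p ^ k : ℕ))) := by
      have e : (((x₀ + p ^ μ * s : ℕ) : ℝ) * h₁ + ((y₀ + p ^ μ * t : ℕ) : ℝ) * h₂) / (p ^ μ * p ^ k : ℕ) =
          ((x₀ : ℝ) * h₁ / (p ^ μ * p ^ k : ℕ) + (y₀ : ℝ) * h₂ / (p ^ μ * p ^ k : ℕ)) +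
            ((s : ℝ) * h₁ / (p ^ k : ℕ) + (t : ℝ) * h₂ / (p ^ k : ℕ)) := by
        push_cast; field_simp; ring
      rw [e]
      simp only [AddChar.map_add_eq_mul, Circle.coe_mul]
    rw [hΦ, hΨ]; dsimp only
    by_cases hx : ¬ p ∣ x₀
    · rw [if_pos (ex.mpr hx), if_pos hx]
      by_cases hy : ¬ p ∣ y₀
      · rw [if_pos (ey.mpr hy), if_pos hy]
        by_cases hc : ((p ^ μ : ℕ) : ℤ) ∣ a * (x₀ : ℤ) ^ 2 - (y₀ : ℤ) ^ 2
        · rw [if_pos (ec.mpr hc), if_pos hc, eph]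
        · rw [if_neg (fun h => hc (ec.mp h)), if_neg hc, zero_mul]
      · rw [if_neg (fun h => hy (ey.mp h)), if_neg hy, zero_mul]
    · rw [if_neg (fun h => hx (ex.mp h)), if_neg hx, zero_mul]
  rw [h1, h2, sum_range_mul_shift]
  simp_rw [sum_range_mul_shift (p ^ μ) (p ^ k) (fun y => Φ (_ + p ^ μ * _) y), hpt]
  -- Σ_s Σ_x₀ Σ_t Σ_y₀ Ψ x₀ y₀ * (u s * v t) = (Σ u)(Σ v) Σ Σ Ψ
  set u : ℕ → ℂ := fun s => (𝐞 ((s : ℝ) * h₁ / (p ^ k : ℕ)) : ℂ) with hu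
  set v : ℕ → ℂ := fun t => (𝐞 ((t : ℝ) * h₂ / (p ^ k : ℕ)) : ℂ) with hv
  calc ∑ s ∈ range (p ^ k), ∑ x₀ ∈ range (p ^ μ), ∑ t ∈ range (p ^ k), ∑ y₀ ∈ range (p ^ μ),
        Ψ x₀ y₀ * (u s * v t)
      = ∑ s ∈ range (p ^ k), ∑ t ∈ range (p ^ k), ∑ x₀ ∈ range (p ^ μ), ∑ y₀ ∈ range (p ^ μ),
        Ψ x₀ y₀ * (u s * v t) := by
        refine sum_congr rfl fun s _ => ?_
        rw [sum_comm]
    _ = ∑ s ∈ range (p ^ k), ∑ t ∈ range (p ^ k), (u s * v t) *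
        ∑ x₀ ∈ range (p ^ μ), ∑ y₀ ∈ range (p ^ μ), Ψ x₀ y₀ := by
        refine sum_congr rfl fun s _ => sum_congr rfl fun t _ => ?_
        rw [mul_sum]
        refine sum_congr rfl fun x₀ _ => ?_
        rw [mul_sum]
        refine sum_congr rfl fun y₀ _ => ?_
        ring
    _ = (∑ s ∈ range (p ^ k), ∑ t ∈ range (p ^ k), u s * v t) *
        ∑ x₀ ∈ range (p ^ μ), ∑ y₀ ∈ range (p ^ μ), Ψ x₀ y₀ := by
        rw [sum_mul]
        refine sum_congr rfl fun s _ => ?_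
        rw [sum_mul]
    _ = _ := by
        congr 1
        exact (sum_mul_sum _ _ _ _).symm

/-- The square roots of `a` modulo `p^μ`: `{ω < p^μ : ω² ≡ a (mod p^μ)}`. [folklore] -/
def sqrtSet (p μ : ℕ) (a : ℤ) : Finset ℕ :=
  (range (p ^ μ)).filter (fun ω => ((p ^ μ : ℕ) : ℤ) ∣ (ω : ℤ) ^ 2 - a)

/-- At most four square roots of a unit modulo a prime power. [folklore] -/
theorem card_sqrtSet_le_four (μ : ℕ) {a : ℤ} (ha : ¬ (p : ℤ) ∣ a) : #(sqrtSet p μ a) ≤ 4 := by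
  have h := card_filter_unitSq_le_four hp μ 1 ha
  unfold sqrtSet
  convert h using 2
  ext ω
  simp only [mem_filter, one_mul, Nat.cast_pow]

/-- **Roots parametrise the fibre**: for a unit `x₀ (mod p^μ)`, `μ ≥ 1`, `p ∤ a`, the units `y₀` with
`y₀² ≡ a x₀² (mod p^μ)` are exactly `ω x₀ (mod p^μ)`, `ω` a square root of `a`. [folklore] -/
theorem sum_fibre_eq_sum_sqrtSet {μ : ℕ} (hμ : 0 < μ) {a : ℤ} (ha : ¬ (p : ℤ) ∣ a) {x₀ : ℕ}
    (hx₀ : ¬ p ∣ x₀) (g : ℕ → ℂ) :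
    ∑ y₀ ∈ (range (p ^ μ)).filter (fun y => ¬ p ∣ y),
      (if ((p ^ μ : ℕ) : ℤ) ∣ a * (x₀ : ℤ) ^ 2 - (y₀ : ℤ) ^ 2 then g y₀ else 0) =
      ∑ ω ∈ sqrtSet p μ a, g (ω * x₀ % p ^ μ) := by
  set q := p ^ μ with hq
  have hq1 : 1 < q := Nat.one_lt_pow hμ.ne' hp.one_lt
  have hq0 : 0 < q := by omega
  have hpp : Prime (p : ℤ) := Nat.prime_iff_prime_int.mp hp
  have hpq : (p : ℤ) ∣ (q : ℤ) := by rw [hq]; exact_mod_cast dvd_pow_self p hμ.ne'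
  -- the inverse of `x₀`
  have hcop : Nat.Coprime x₀ q := (Nat.coprime_pow_right_iff hμ _ _).mpr
    ((Nat.coprime_comm).mp ((hp.coprime_iff_not_dvd).mpr hx₀))
  obtain ⟨xi, -, hxi⟩ := Nat.exists_mul_mod_eq_one_of_coprime hcop hq1
  have hxiZ : (x₀ : ℤ) * xi ≡ 1 [ZMOD q] := by
    have : ((x₀ * xi % q : ℕ) : ℤ) = 1 := by exact_mod_cast hxi
    rw [Int.natCast_mod] at this
    calc (x₀ : ℤ) * xi = ((x₀ * xi : ℕ) : ℤ) := by push_cast; ring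
      _ ≡ ((x₀ * xi : ℕ) : ℤ) % q [ZMOD q] := (Int.mod_modEq _ _).symm
      _ = 1 := this
  have hmodZ : ∀ n : ℕ, ((n % q : ℕ) : ℤ) ≡ n [ZMOD q] := fun n => by
    rw [Int.natCast_mod]; exact Int.mod_modEq _ _
  rw [← sum_filter]
  symm
  refine sum_nbij' (fun ω => ω * x₀ % q) (fun y => y * xi % q) ?_ ?_ ?_ ?_ ?_
  · -- maps roots into the fibre
    intro ω hω
    obtain ⟨-, hωa⟩ := mem_filter.mp hω
    rw [mem_filter, mem_filter, mem_range]
    refine ⟨⟨Nat.mod_lt _ hq0, ?_⟩, ?_⟩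
    · -- `p ∤ ω x₀`
      intro hdvd
      have h1 : (p : ℤ) ∣ ((ω * x₀ % q : ℕ) : ℤ) := by exact_mod_cast hdvd
      have h2 : (p : ℤ) ∣ (ω : ℤ) * x₀ := by
        have h3 := (Int.ModEq.dvd ((hmodZ (ω * x₀)).symm))
        -- q ∣ (ω x₀ % q) - ω x₀
        have h4 : (p : ℤ) ∣ ((ω * x₀ % q : ℕ) : ℤ) - ((ω * x₀ : ℕ) : ℤ) := hpq.trans h3
        have h5 := dvd_sub h1 h4
        rw [sub_sub_cancel] at h5
        exact_mod_cast h5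
      rcases hpp.dvd_or_dvd h2 with h6 | h6
      · -- `p ∣ ω` contradicts `ω² ≡ a`, `p ∤ a`
        have h7 : (p : ℤ) ∣ (ω : ℤ) ^ 2 - a := hpq.trans hωa
        have h8 : (p : ℤ) ∣ (ω : ℤ) ^ 2 := Dvd.dvd.pow h6 two_ne_zero
        have := dvd_sub h8 h7
        rw [sub_sub_cancel] at this
        exact ha this
      · exact hx₀ (Int.natCast_dvd_natCast.mp h6)
    · -- the congruence
      have h1 : ((ω * x₀ % q : ℕ) : ℤ) ^ 2 ≡ ((ω : ℤ) * x₀) ^ 2 [ZMOD q] := by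
        have := (hmodZ (ω * x₀)).pow 2
        push_cast at this ⊢
        exact this
      have h2 : (q : ℤ) ∣ a * (x₀ : ℤ) ^ 2 - ((ω : ℤ) * x₀) ^ 2 := by
        have e : a * (x₀ : ℤ) ^ 2 - ((ω : ℤ) * x₀) ^ 2 = -(((ω : ℤ) ^ 2 - a) * (x₀ : ℤ) ^ 2) := by ring
        rw [e, dvd_neg]
        exact Dvd.dvd.mul_right hωa _
      have h3 := Int.ModEq.dvd h1  -- q ∣ (ω x₀)^2 - (…%q)^2
      have := dvd_add h2 h3
      have e : a * (x₀ : ℤ) ^ 2 - ((ω : ℤ) * x₀) ^ 2 + (((ω : ℤ) * x₀) ^ 2 - ((ω * x₀ % q : ℕ) : ℤ) ^ 2) =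
          a * (x₀ : ℤ) ^ 2 - ((ω * x₀ % q : ℕ) : ℤ) ^ 2 := by ring
      rwa [e] at this
  · -- maps the fibre into the roots
    intro y hy
    have hya : (q : ℤ) ∣ a * (x₀ : ℤ) ^ 2 - (y : ℤ) ^ 2 := (mem_filter.mp hy).2
    rw [sqrtSet, mem_filter, mem_range]
    refine ⟨Nat.mod_lt _ hq0, ?_⟩
    have h1 : ((y * xi % q : ℕ) : ℤ) ^ 2 ≡ ((y : ℤ) * xi) ^ 2 [ZMOD q] := by
      have := (hmodZ (y * xi)).pow 2
      push_cast at this ⊢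
      exact this
    -- y² xi² ≡ a x₀² xi² ≡ a
    have h2 : ((y : ℤ) * xi) ^ 2 ≡ a [ZMOD q] := by
      have h3 : (y : ℤ) ^ 2 ≡ a * (x₀ : ℤ) ^ 2 [ZMOD q] := (Int.modEq_iff_dvd.mpr hya)
      calc ((y : ℤ) * xi) ^ 2 = (y : ℤ) ^ 2 * (xi : ℤ) ^ 2 := by ring
        _ ≡ a * (x₀ : ℤ) ^ 2 * (xi : ℤ) ^ 2 [ZMOD q] := h3.mul_right _
        _ = a * ((x₀ : ℤ) * xi) ^ 2 := by ring
        _ ≡ a * 1 ^ 2 [ZMOD q] := (hxiZ.pow 2).mul_left a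
        _ = a := by ring
    exact (Int.ModEq.dvd (h1.trans h2).symm)
  · -- left inverse
    intro ω hω
    obtain ⟨hωr, -⟩ := mem_filter.mp hω
    rw [mem_range] at hωr
    rw [Nat.mul_mod, Nat.mod_mod, ← Nat.mul_mod, mul_assoc, Nat.mul_mod, hxi, mul_one, Nat.mod_mod,
      Nat.mod_eq_of_lt hωr]
  · -- right inverse
    intro y hy
    have hyr : y < q := mem_range.mp (mem_filter.mp (mem_filter.mp hy).1).1
    rw [Nat.mul_mod, Nat.mod_mod, ← Nat.mul_mod, mul_assoc, mul_comm xi x₀, Nat.mul_mod, hxi, mul_one,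
      Nat.mod_mod, Nat.mod_eq_of_lt hyr]
  · intro ω _; rfl

/-- **The core is a sum of Ramanujan sums**: with `h_i = p^k h_i'`,
`coreSum = Σ_{ω² ≡ a (p^μ)} c_{p^μ}(h₁' + ω h₂')`. [cite: FriedlanderIwaniecAnnals1998, (8.3)] -/
theorem coreSum_eq_sum_ramanujanSum {μ : ℕ} (hμ : 0 < μ) (k : ℕ) {a : ℤ} (ha : ¬ (p : ℤ) ∣ a)
    (h₁' h₂' : ℤ) :
    coreSum p μ k a ((p ^ k : ℕ) * h₁') ((p ^ k : ℕ) * h₂') =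
      ∑ ω ∈ sqrtSet p μ a, ramanujanSum (p ^ μ) (h₁' + ω * h₂') := by
  set q := p ^ μ with hq
  have hq0 : (q : ℝ) ≠ 0 := by rw [hq]; exact_mod_cast (pow_pos hp.pos μ).ne'
  have hpk0 : ((p ^ k : ℕ) : ℝ) ≠ 0 := by exact_mod_cast (pow_pos hp.pos k).ne'
  have hph : ∀ (x : ℕ) (h : ℤ), (𝐞 ((x : ℝ) * (((p ^ k : ℕ) * h : ℤ)) / (p ^ μ * p ^ k : ℕ)) : ℂ) =
      𝐞 ((x : ℝ) * h / q) := by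
    intro x h
    have hp0 : (0 : ℝ) < p := by exact_mod_cast hp.pos
    have e : (x : ℝ) * (((p ^ k : ℕ) * h : ℤ)) / (p ^ μ * p ^ k : ℕ) = (x : ℝ) * h / q := by
      rw [hq]; push_cast
      rw [div_eq_div_iff (by positivity) (by positivity)]; ring
    rw [e]
  unfold coreSum
  simp_rw [hph]
  rw [← hq]
  -- parametrise the fibres
  have hfib : ∀ x₀ ∈ (range q).filter (fun x => ¬ p ∣ x),
      (∑ y₀ ∈ (range q).filter (fun y => ¬ p ∣ y),
        (if ((q : ℕ) : ℤ) ∣ a * (x₀ : ℤ) ^ 2 - (y₀ : ℤ) ^ 2 then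
          (𝐞 ((x₀ : ℝ) * h₁' / q) : ℂ) * 𝐞 ((y₀ : ℝ) * h₂' / q) else 0)) =
      ∑ ω ∈ sqrtSet p μ a, (𝐞 ((x₀ : ℝ) * h₁' / q) : ℂ) * 𝐞 (((ω * x₀ : ℕ) : ℝ) * h₂' / q) := by
    intro x₀ hx₀
    have hx₀' : ¬ p ∣ x₀ := (mem_filter.mp hx₀).2
    rw [hq, sum_fibre_eq_sum_sqrtSet hp hμ ha hx₀' (fun y₀ => (𝐞 ((x₀ : ℝ) * h₁' / q) : ℂ) * 𝐞 ((y₀ : ℝ) * h₂' / q)),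
      ← hq]
    refine sum_congr rfl fun ω _ => ?_
    rw [fourierChar_mod_mul_div]
  rw [sum_congr rfl hfib, sum_comm]
  refine sum_congr rfl fun ω _ => ?_
  rw [ramanujanSum]
  have hU : (range q).filter (fun x => ¬ p ∣ x) = (range q).filter (fun x : ℕ => x.Coprime q) := by
    refine filter_congr fun x _ => ?_
    rw [hq, Nat.coprime_pow_right_iff hμ, Nat.coprime_comm, hp.coprime_iff_not_dvd]
  rw [hU]
  refine sum_congr rfl fun x _ => ?_
  rw [← Circle.coe_mul, ← AddChar.map_add_eq_mul]
  congr 2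
  push_cast
  ring

/-- `|coreSum| ≤ 4 (h₁'² - a h₂'², p^μ)` for `h_i = p^k h_i'`. [cite: FriedlanderIwaniecAnnals1998, (8.3)-(8.5)] -/
theorem norm_coreSum_le {μ : ℕ} (hμ : 0 < μ) (k : ℕ) {a : ℤ} (ha : ¬ (p : ℤ) ∣ a) (h₁' h₂' : ℤ) :
    ‖coreSum p μ k a ((p ^ k : ℕ) * h₁') ((p ^ k : ℕ) * h₂')‖ ≤
      4 * Nat.gcd (h₁' ^ 2 - a * h₂' ^ 2).natAbs (p ^ μ) := by
  rw [coreSum_eq_sum_ramanujanSum hp hμ k ha]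
  have hg0 : 0 < Nat.gcd (h₁' ^ 2 - a * h₂' ^ 2).natAbs (p ^ μ) :=
    Nat.gcd_pos_of_pos_right _ (pow_pos hp.pos μ)
  have hterm : ∀ ω ∈ sqrtSet p μ a, ‖ramanujanSum (p ^ μ) (h₁' + ω * h₂')‖ ≤
      Nat.gcd (h₁' ^ 2 - a * h₂' ^ 2).natAbs (p ^ μ) := by
    intro ω hω
    have hωa : ((p ^ μ : ℕ) : ℤ) ∣ (ω : ℤ) ^ 2 - a := (mem_filter.mp hω).2
    refine (norm_ramanujanSum_prime_pow_le hp μ _).trans ?_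
    have hdvd : Nat.gcd (h₁' + ω * h₂').natAbs (p ^ μ) ∣ Nat.gcd (h₁' ^ 2 - a * h₂' ^ 2).natAbs (p ^ μ) := by
      refine Nat.dvd_gcd ?_ (Nat.gcd_dvd_right _ _)
      have h1 : ((Nat.gcd (h₁' + ω * h₂').natAbs (p ^ μ) : ℕ) : ℤ) ∣ h₁' + ω * h₂' :=
        Int.natCast_dvd.mpr (Nat.gcd_dvd_left _ _)
      have h2 : ((Nat.gcd (h₁' + ω * h₂').natAbs (p ^ μ) : ℕ) : ℤ) ∣ (ω : ℤ) ^ 2 - a :=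
        (Int.natCast_dvd_natCast.mpr (Nat.gcd_dvd_right _ _)).trans hωa
      have e : h₁' ^ 2 - a * h₂' ^ 2 = (h₁' + ω * h₂') * (h₁' - ω * h₂') + ((ω : ℤ) ^ 2 - a) * h₂' ^ 2 := by
        ring
      have h3 : ((Nat.gcd (h₁' + ω * h₂').natAbs (p ^ μ) : ℕ) : ℤ) ∣ h₁' ^ 2 - a * h₂' ^ 2 := by
        rw [e]; exact dvd_add (Dvd.dvd.mul_right h1 _) (Dvd.dvd.mul_right h2 _)
      exact Int.natCast_dvd.mp h3
    exact_mod_cast Nat.le_of_dvd hg0 hdvd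
  calc ‖∑ ω ∈ sqrtSet p μ a, ramanujanSum (p ^ μ) (h₁' + ω * h₂')‖
      ≤ ∑ ω ∈ sqrtSet p μ a, ‖ramanujanSum (p ^ μ) (h₁' + ω * h₂')‖ := norm_sum_le _ _
    _ ≤ ∑ ω ∈ sqrtSet p μ a, (Nat.gcd (h₁' ^ 2 - a * h₂' ^ 2).natAbs (p ^ μ) : ℝ) := sum_le_sum hterm
    _ = #(sqrtSet p μ a) * Nat.gcd (h₁' ^ 2 - a * h₂' ^ 2).natAbs (p ^ μ) := by
        rw [sum_const, nsmul_eq_mul]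
    _ ≤ 4 * Nat.gcd (h₁' ^ 2 - a * h₂' ^ 2).natAbs (p ^ μ) := by
        gcongr
        exact_mod_cast card_sqrtSet_le_four hp μ ha

/-- **Bound for an exact block**: `|blockSum p μ k a h₁ h₂| ≤ 4 (h₁² - a h₂², p^{μ+2k})` (`μ ≥ 1`).
[cite: FriedlanderIwaniecAnnals1998, (8.3)-(8.5)] -/
theorem norm_blockSum_le {μ : ℕ} (hμ : 0 < μ) (k : ℕ) {a : ℤ} (ha : ¬ (p : ℤ) ∣ a) (h₁ h₂ : ℤ) :
    ‖blockSum p μ k a h₁ h₂‖ ≤ 4 * Nat.gcd (h₁ ^ 2 - a * h₂ ^ 2).natAbs (p ^ (μ + 2 * k)) := by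
  have hpk : p ^ k ≠ 0 := (pow_pos hp.pos k).ne'
  have hg0 : 0 < Nat.gcd (h₁ ^ 2 - a * h₂ ^ 2).natAbs (p ^ (μ + 2 * k)) :=
    Nat.gcd_pos_of_pos_right _ (pow_pos hp.pos _)
  rw [blockSum_eq hp hμ, sum_range_fourierChar_div hpk, sum_range_fourierChar_div hpk]
  by_cases hd1 : ((p ^ k : ℕ) : ℤ) ∣ h₁
  · by_cases hd2 : ((p ^ k : ℕ) : ℤ) ∣ h₂
    · obtain ⟨h₁', rfl⟩ := hd1
      obtain ⟨h₂', rfl⟩ := hd2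
      rw [if_pos (dvd_mul_right _ _), if_pos (dvd_mul_right _ _), norm_mul, norm_mul,
        Complex.norm_natCast]
      have hcore := norm_coreSum_le hp hμ k ha h₁' h₂'
      have e : Nat.gcd ((((p ^ k : ℕ) : ℤ) * h₁') ^ 2 - a * (((p ^ k : ℕ) : ℤ) * h₂') ^ 2).natAbs (p ^ (μ + 2 * k)) =
          p ^ k * p ^ k * Nat.gcd (h₁' ^ 2 - a * h₂' ^ 2).natAbs (p ^ μ) := by
        have e1 : (((p ^ k : ℕ) : ℤ) * h₁') ^ 2 - a * (((p ^ k : ℕ) : ℤ) * h₂') ^ 2 =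
            ((p ^ k * p ^ k : ℕ) : ℤ) * (h₁' ^ 2 - a * h₂' ^ 2) := by push_cast; ring
        rw [e1, Int.natAbs_mul, Int.natAbs_natCast, show p ^ (μ + 2 * k) = p ^ k * p ^ k * p ^ μ by
          rw [← pow_add, ← pow_add]; congr 1; omega, Nat.gcd_mul_left]
      rw [e, Nat.cast_mul, Nat.cast_mul]
      have h0 : (0 : ℝ) ≤ ((p ^ k : ℕ) : ℝ) * ((p ^ k : ℕ) : ℝ) := by positivity
      calc ((p ^ k : ℕ) : ℝ) * ((p ^ k : ℕ) : ℝ) * ‖coreSum p μ k a ((p ^ k : ℕ) * h₁') ((p ^ k : ℕ) * h₂')‖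
          ≤ ((p ^ k : ℕ) : ℝ) * ((p ^ k : ℕ) : ℝ) * (4 * Nat.gcd (h₁' ^ 2 - a * h₂' ^ 2).natAbs (p ^ μ)) :=
            mul_le_mul_of_nonneg_left hcore h0
        _ = _ := by ring
    · rw [if_neg hd2, mul_zero, zero_mul, norm_zero]; positivity
  · rw [if_neg hd1, zero_mul, zero_mul, norm_zero]; positivity

/-- **FI (8.5) locally**: for `p ∤ a`,
`|S_{p^ν}(a; h₁, h₂)| ≤ (2ν + 3) (h₁² - a h₂², p^ν)`. [cite: FriedlanderIwaniecAnnals1998, Lemma 8.1] -/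
theorem norm_quadExpSum_prime_pow_le (ν : ℕ) {a : ℤ} (ha : ¬ (p : ℤ) ∣ a) (h₁ h₂ : ℤ) :
    ‖quadExpSum (p ^ ν) a h₁ h₂‖ ≤ (2 * ν + 3) * Nat.gcd (h₁ ^ 2 - a * h₂ ^ 2).natAbs (p ^ ν) := by
  set m := ν - ν / 2 with hm
  set g : ℝ := ((Nat.gcd (h₁ ^ 2 - a * h₂ ^ 2).natAbs (p ^ ν) : ℕ) : ℝ) with hg
  have hg0 : 0 ≤ g := by rw [hg]; positivity
  rw [quadExpSum_def, sum_range_eq_sum_dvd_add_sum_exactPow p (p ^ ν) m]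
  refine (norm_add_le _ _).trans ?_
  have hZ := norm_zeroBlock_le hp ν a h₁ h₂
  have hB : ∀ k ∈ range m, ‖∑ x ∈ (range (p ^ ν)).filter (fun x => p ^ k ∣ x ∧ ¬ p ^ (k + 1) ∣ x),
      ∑ y ∈ range (p ^ ν), (if ((p ^ ν : ℕ) : ℤ) ∣ a * (x : ℤ) ^ 2 - (y : ℤ) ^ 2 then
        (𝐞 (((x : ℝ) * h₁ + (y : ℝ) * h₂) / (p ^ ν : ℕ)) : ℂ) else 0)‖ ≤ 4 * g := by
    intro k hk
    rw [mem_range] at hk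
    have h2k : 2 * k < ν := by omega
    rw [exactBlock_eq_blockSum hp h2k ha]
    have := norm_blockSum_le hp (by omega : 0 < ν - 2 * k) k ha h₁ h₂
    rwa [show ν - 2 * k + 2 * k = ν by omega] at this
  calc ‖∑ x ∈ (range (p ^ ν)).filter (fun x => p ^ m ∣ x), ∑ y ∈ range (p ^ ν),
        (if ((p ^ ν : ℕ) : ℤ) ∣ a * (x : ℤ) ^ 2 - (y : ℤ) ^ 2 then
          (𝐞 (((x : ℝ) * h₁ + (y : ℝ) * h₂) / (p ^ ν : ℕ)) : ℂ) else 0)‖ +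
      ‖∑ k ∈ range m, ∑ x ∈ (range (p ^ ν)).filter (fun x => p ^ k ∣ x ∧ ¬ p ^ (k + 1) ∣ x),
        ∑ y ∈ range (p ^ ν), (if ((p ^ ν : ℕ) : ℤ) ∣ a * (x : ℤ) ^ 2 - (y : ℤ) ^ 2 then
          (𝐞 (((x : ℝ) * h₁ + (y : ℝ) * h₂) / (p ^ ν : ℕ)) : ℂ) else 0)‖
      ≤ g + ∑ k ∈ range m, 4 * g := by
        gcongr
        exact (norm_sum_le _ _).trans (sum_le_sum hB)
    _ = (1 + 4 * m) * g := by rw [sum_const, card_range, nsmul_eq_mul]; ring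
    _ ≤ (2 * ν + 3) * g := by
        refine mul_le_mul_of_nonneg_right ?_ hg0
        have : (m : ℝ) * 2 ≤ ν + 1 := by
          have h : m * 2 ≤ ν + 1 := by omega
          exact_mod_cast h
        linarith

end Local

/-! ### The Chinese remainder theorem for `S_q` -/

/-- Sums over `x < m n` factor through `(x mod m, x mod n)` for coprime `m, n` (CRT bijection).
[folklore] -/
theorem sum_range_mul_coprime {M : Type*} [AddCommMonoid M] {m n : ℕ} (hm : 0 < m) (hn : 0 < n)
    (hmn : m.Coprime n) (F : ℕ → ℕ → M) :
    ∑ x ∈ range (m * n), F (x % m) (x % n) = ∑ i ∈ range m, ∑ j ∈ range n, F i j := by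
  rw [← sum_product' (range m) (range n) F]
  refine sum_nbij' (fun x => (x % m, x % n)) (fun ij => (Nat.chineseRemainder hmn ij.1 ij.2 : ℕ))
    ?_ ?_ ?_ ?_ ?_
  · intro x _
    exact mem_product.mpr ⟨mem_range.mpr (Nat.mod_lt _ hm), mem_range.mpr (Nat.mod_lt _ hn)⟩
  · intro ij _
    exact mem_range.mpr (Nat.chineseRemainder_lt_mul hmn ij.1 ij.2 hm.ne' hn.ne')
  · intro x hx
    rw [mem_range] at hx
    set c := Nat.chineseRemainder hmn (x % m) (x % n) with hc
    have h1 : (c : ℕ) ≡ x [MOD m] := c.2.1.trans (Nat.mod_modEq x m)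
    have h2 : (c : ℕ) ≡ x [MOD n] := c.2.2.trans (Nat.mod_modEq x n)
    have h3 : (c : ℕ) ≡ x [MOD m * n] := (Nat.modEq_and_modEq_iff_modEq_mul hmn).mp ⟨h1, h2⟩
    exact Nat.ModEq.eq_of_lt_of_lt h3 (Nat.chineseRemainder_lt_mul hmn _ _ hm.ne' hn.ne') hx
  · intro ij hij
    obtain ⟨hi, hj⟩ := mem_product.mp hij
    rw [mem_range] at hi hj
    set c := Nat.chineseRemainder hmn ij.1 ij.2 with hc
    have h1 : (c : ℕ) % m = ij.1 := by
      have := c.2.1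
      rw [Nat.ModEq] at this
      rw [this, Nat.mod_eq_of_lt hi]
    have h2 : (c : ℕ) % n = ij.2 := by
      have := c.2.2
      rw [Nat.ModEq] at this
      rw [this, Nat.mod_eq_of_lt hj]
    exact Prod.ext h1 h2
  · intro x _; rfl

/-- A polynomial congruence in two variables only depends on the residues. [folklore] -/
theorem dvd_quadForm_mod_iff {d : ℕ} (hd : 0 < d) (a : ℤ) (x y : ℕ) {q : ℕ} (hdq : d ∣ q) :
    (d : ℤ) ∣ a * ((x % q : ℕ) : ℤ) ^ 2 - ((y % q : ℕ) : ℤ) ^ 2 ↔ (d : ℤ) ∣ a * (x : ℤ) ^ 2 - (y : ℤ) ^ 2 := by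
  have hx : ((x % q : ℕ) : ℤ) ≡ x [ZMOD d] := by
    rw [Int.natCast_mod]
    exact Int.ModEq.of_dvd (Int.natCast_dvd_natCast.mpr hdq) (Int.mod_modEq _ _)
  have hy : ((y % q : ℕ) : ℤ) ≡ y [ZMOD d] := by
    rw [Int.natCast_mod]
    exact Int.ModEq.of_dvd (Int.natCast_dvd_natCast.mpr hdq) (Int.mod_modEq _ _)
  have _ := hd
  exact (((hx.pow 2).mul_left a).sub (hy.pow 2)).dvd_iff

/-- `e(T/(mn)) = e(vT/m) e(uT/n)` when `u m + v n = 1`, with the residues reduced. [folklore] -/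
theorem fourierChar_crt {m n : ℕ} (hm : 0 < m) (hn : 0 < n) {u v : ℤ} (huv : u * m + v * n = 1)
    (x y : ℕ) (h₁ h₂ : ℤ) :
    (𝐞 (((x : ℝ) * h₁ + (y : ℝ) * h₂) / (m * n : ℕ)) : ℂ) =
      (𝐞 ((((x % m : ℕ) : ℝ) * ((v * h₁ : ℤ) : ℝ) + ((y % m : ℕ) : ℝ) * ((v * h₂ : ℤ) : ℝ)) / m) : ℂ) *
        𝐞 ((((x % n : ℕ) : ℝ) * ((u * h₁ : ℤ) : ℝ) + ((y % n : ℕ) : ℝ) * ((u * h₂ : ℤ) : ℝ)) / n) := by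
  have hm0 : (m : ℝ) ≠ 0 := by exact_mod_cast hm.ne'
  have hn0 : (n : ℝ) ≠ 0 := by exact_mod_cast hn.ne'
  have huvR : (u : ℝ) * m + v * n = 1 := by exact_mod_cast huv
  have key : ((x : ℝ) * h₁ + (y : ℝ) * h₂) / (m * n : ℕ) =
      ((x : ℝ) * ((v * h₁ : ℤ) : ℝ) + (y : ℝ) * ((v * h₂ : ℤ) : ℝ)) / m +
        ((x : ℝ) * ((u * h₁ : ℤ) : ℝ) + (y : ℝ) * ((u * h₂ : ℤ) : ℝ)) / n := by
    push_cast
    rw [div_add_div _ _ hm0 hn0, div_eq_div_iff (mul_ne_zero hm0 hn0) (mul_ne_zero hm0 hn0)]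
    linear_combination (-(((x : ℝ) * h₁ + (y : ℝ) * h₂) * (m * n))) * huvR
  rw [key, AddChar.map_add_eq_mul, Circle.coe_mul, fourierChar_add_div, fourierChar_add_div,
    fourierChar_add_div, fourierChar_add_div,
    fourierChar_mod_mul_div, fourierChar_mod_mul_div, fourierChar_mod_mul_div, fourierChar_mod_mul_div]

/-- **Twisted multiplicativity of `S_q`** (CRT): for coprime `m, n` and `u m + v n = 1`,
`S_{mn}(a; h₁, h₂) = S_m(a; v h₁, v h₂) S_n(a; u h₁, u h₂)`.
[cite: FriedlanderIwaniecAnnals1998, (8.9) ("Since `N(a; q)` is multiplicative")] -/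
theorem quadExpSum_mul_of_coprime {m n : ℕ} (hm : 0 < m) (hn : 0 < n) (hmn : m.Coprime n) {u v : ℤ}
    (huv : u * m + v * n = 1) (a h₁ h₂ : ℤ) :
    quadExpSum (m * n) a h₁ h₂ = quadExpSum m a (v * h₁) (v * h₂) * quadExpSum n a (u * h₁) (u * h₂) := by
  set A : ℕ → ℕ → ℂ := fun i i' => if (m : ℤ) ∣ a * (i : ℤ) ^ 2 - (i' : ℤ) ^ 2 then
    (𝐞 (((i : ℝ) * ((v * h₁ : ℤ) : ℝ) + (i' : ℝ) * ((v * h₂ : ℤ) : ℝ)) / m) : ℂ) else 0 with hA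
  set B : ℕ → ℕ → ℂ := fun j j' => if (n : ℤ) ∣ a * (j : ℤ) ^ 2 - (j' : ℤ) ^ 2 then
    (𝐞 (((j : ℝ) * ((u * h₁ : ℤ) : ℝ) + (j' : ℝ) * ((u * h₂ : ℤ) : ℝ)) / n) : ℂ) else 0 with hB
  have hcopZ : IsCoprime (m : ℤ) (n : ℤ) := Nat.isCoprime_iff_coprime.mpr hmn
  -- pointwise factorisation
  have hpt : ∀ x y : ℕ, (if ((m * n : ℕ) : ℤ) ∣ a * (x : ℤ) ^ 2 - (y : ℤ) ^ 2 then
      (𝐞 (((x : ℝ) * h₁ + (y : ℝ) * h₂) / (m * n : ℕ)) : ℂ) else 0) =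
      A (x % m) (y % m) * B (x % n) (y % n) := by
    intro x y
    rw [hA, hB]; dsimp only
    have em := dvd_quadForm_mod_iff hm a x y (dvd_refl m)
    have en := dvd_quadForm_mod_iff hn a x y (dvd_refl n)
    by_cases hmd : (m : ℤ) ∣ a * (x : ℤ) ^ 2 - (y : ℤ) ^ 2
    · by_cases hnd : (n : ℤ) ∣ a * (x : ℤ) ^ 2 - (y : ℤ) ^ 2
      · rw [if_pos (em.mpr hmd), if_pos (en.mpr hnd), if_pos, fourierChar_crt hm hn huv]
        push_cast
        exact hcopZ.mul_dvd hmd hnd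
      · rw [if_neg (fun h => hnd (en.mp h)), mul_zero, if_neg]
        intro h; push_cast at h; exact hnd (dvd_of_mul_left_dvd h)
    · rw [if_neg (fun h => hmd (em.mp h)), zero_mul, if_neg]
      intro h; push_cast at h; exact hmd (dvd_of_mul_right_dvd h)
  have hA' : quadExpSum m a (v * h₁) (v * h₂) = ∑ i ∈ range m, ∑ i' ∈ range m, A i i' := rfl
  have hB' : quadExpSum n a (u * h₁) (u * h₂) = ∑ j ∈ range n, ∑ j' ∈ range n, B j j' := rfl
  rw [quadExpSum_def, hA', hB']
  simp_rw [hpt]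
  calc ∑ x ∈ range (m * n), ∑ y ∈ range (m * n), A (x % m) (y % m) * B (x % n) (y % n)
      = ∑ x ∈ range (m * n), ∑ i' ∈ range m, ∑ j' ∈ range n, A (x % m) i' * B (x % n) j' := by
        refine sum_congr rfl fun x _ => ?_
        exact sum_range_mul_coprime hm hn hmn (fun i' j' => A (x % m) i' * B (x % n) j')
    _ = ∑ i ∈ range m, ∑ j ∈ range n, ∑ i' ∈ range m, ∑ j' ∈ range n, A i i' * B j j' :=
        sum_range_mul_coprime hm hn hmn (fun i j => ∑ i' ∈ range m, ∑ j' ∈ range n, A i i' * B j j')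
    _ = ∑ i ∈ range m, ∑ j ∈ range n, (∑ i' ∈ range m, A i i') * ∑ j' ∈ range n, B j j' := by
        refine sum_congr rfl fun i _ => sum_congr rfl fun j _ => ?_
        rw [sum_mul_sum]
    _ = ∑ i ∈ range m, (∑ i' ∈ range m, A i i') * ∑ j ∈ range n, ∑ j' ∈ range n, B j j' := by
        refine sum_congr rfl fun i _ => ?_
        rw [mul_sum]
    _ = _ := by rw [sum_mul]

/-! ### The global bound -/

/-- **FI Lemma 8.1 for `S_q` (crude form).** For `q ≥ 1` and `(a, q) = 1`:
`|S_q(a; h₁, h₂)| ≤ τ(q)⁴ (h₁² - a h₂², q)`. The source has `4 τ₃(q)` in place of `τ(q)⁴`.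
[cite: FriedlanderIwaniecAnnals1998, Lemma 8.1, (8.5)] -/
theorem norm_quadExpSum_le {q : ℕ} (hq : 0 < q) {a : ℤ} (ha : IsCoprime a (q : ℤ)) (h₁ h₂ : ℤ) :
    ‖quadExpSum q a h₁ h₂‖ ≤ (#q.divisors : ℝ) ^ 4 * Nat.gcd (h₁ ^ 2 - a * h₂ ^ 2).natAbs q := by
  induction q using Nat.recOnPosPrimePosCoprime generalizing h₁ h₂ with
  | zero => exact absurd hq (lt_irrefl 0)
  | one =>
    rw [quadExpSum_one]
    simp
  | prime_pow p k hp hk =>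
    have hpa : ¬ (p : ℤ) ∣ a := by
      intro hpa
      have h1 : (p : ℤ) ∣ ((p ^ k : ℕ) : ℤ) := by exact_mod_cast dvd_pow_self p hk.ne'
      have hu := ha.isUnit_of_dvd' hpa h1
      rw [Int.isUnit_iff_natAbs_eq, Int.natAbs_natCast] at hu
      exact hp.one_lt.ne' hu
    refine (norm_quadExpSum_prime_pow_le hp k hpa h₁ h₂).trans ?_
    gcongr
    rw [Nat.divisors_prime_pow hp, card_map, card_range]
    push_cast
    have hk1 : (1 : ℝ) ≤ k := by exact_mod_cast hk
    nlinarith [sq_nonneg ((k : ℝ) + 1), sq_nonneg ((k : ℝ) - 1)]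
  | coprime m n hm hn hmn ihm ihn =>
    have hm0 : 0 < m := by omega
    have hn0 : 0 < n := by omega
    obtain ⟨u, v, huv⟩ := (Nat.isCoprime_iff_coprime.mpr hmn : IsCoprime (m : ℤ) (n : ℤ))
    have ham : IsCoprime a (m : ℤ) := by
      have : IsCoprime a ((m : ℤ) * n) := by exact_mod_cast ha
      exact this.of_mul_right_left
    have han : IsCoprime a (n : ℤ) := by
      have : IsCoprime a ((m : ℤ) * n) := by exact_mod_cast ha
      exact this.of_mul_right_right
    rw [quadExpSum_mul_of_coprime hm0 hn0 hmn huv, norm_mul]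
    have h1 := ihm hm0 ham (v * h₁) (v * h₂)
    have h2 := ihn hn0 han (u * h₁) (u * h₂)
    -- the twists do not change the gcds
    have hv : Nat.Coprime v.natAbs m := by
      have : IsCoprime v (m : ℤ) := ⟨n, u, by linear_combination huv⟩
      have := Int.isCoprime_iff_gcd_eq_one.mp this
      rwa [Int.gcd_eq_natAbs, Int.natAbs_natCast] at this
    have hu : Nat.Coprime u.natAbs n := by
      have : IsCoprime u (n : ℤ) := ⟨m, v, by linear_combination huv⟩
      have := Int.isCoprime_iff_gcd_eq_one.mp this
      rwa [Int.gcd_eq_natAbs, Int.natAbs_natCast] at this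
    have e1 : Nat.gcd ((v * h₁) ^ 2 - a * (v * h₂) ^ 2).natAbs m = Nat.gcd (h₁ ^ 2 - a * h₂ ^ 2).natAbs m := by
      rw [show (v * h₁) ^ 2 - a * (v * h₂) ^ 2 = v ^ 2 * (h₁ ^ 2 - a * h₂ ^ 2) by ring, Int.natAbs_mul,
        Int.natAbs_pow]
      exact Nat.Coprime.gcd_mul_left_cancel _ (hv.pow_left 2)
    have e2 : Nat.gcd ((u * h₁) ^ 2 - a * (u * h₂) ^ 2).natAbs n = Nat.gcd (h₁ ^ 2 - a * h₂ ^ 2).natAbs n := by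
      rw [show (u * h₁) ^ 2 - a * (u * h₂) ^ 2 = u ^ 2 * (h₁ ^ 2 - a * h₂ ^ 2) by ring, Int.natAbs_mul,
        Int.natAbs_pow]
      exact Nat.Coprime.gcd_mul_left_cancel _ (hu.pow_left 2)
    rw [e1] at h1
    rw [e2] at h2
    rw [Nat.Coprime.card_divisors_mul hmn, Nat.Coprime.gcd_mul _ hmn]
    push_cast
    calc ‖quadExpSum m a (v * h₁) (v * h₂)‖ * ‖quadExpSum n a (u * h₁) (u * h₂)‖
        ≤ ((#m.divisors : ℝ) ^ 4 * Nat.gcd (h₁ ^ 2 - a * h₂ ^ 2).natAbs m) *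
          ((#n.divisors : ℝ) ^ 4 * Nat.gcd (h₁ ^ 2 - a * h₂ ^ 2).natAbs n) :=
          mul_le_mul h1 h2 (norm_nonneg _) (by positivity)
      _ = _ := by ring

/-- **(8.6), crude form**: the number of pairs `γ₁, γ₂ (mod q)` with `a γ₁² ≡ γ₂² (mod q)` is at most
`τ(q)⁴ q` for `(a, q) = 1` (the source: `≤ 4 τ₃(q) q`). [cite: FriedlanderIwaniecAnnals1998, (8.6)] -/
theorem card_quadPairs_le {q : ℕ} (hq : 0 < q) {a : ℤ} (ha : IsCoprime a (q : ℤ)) :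
    (#(((range q) ×ˢ (range q)).filter fun xy : ℕ × ℕ =>
        (q : ℤ) ∣ a * (xy.1 : ℤ) ^ 2 - (xy.2 : ℤ) ^ 2) : ℝ) ≤ (#q.divisors : ℝ) ^ 4 * q := by
  have h := norm_quadExpSum_le hq ha 0 0
  have e : quadExpSum q a 0 0 = (#(((range q) ×ˢ (range q)).filter fun xy : ℕ × ℕ =>
      (q : ℤ) ∣ a * (xy.1 : ℤ) ^ 2 - (xy.2 : ℤ) ^ 2) : ℂ) := by
    rw [quadExpSum_def, card_filter, Nat.cast_sum, sum_product]
    refine sum_congr rfl fun x _ => sum_congr rfl fun y _ => ?_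
    split_ifs
    · simp
    · simp
  rw [e, Complex.norm_natCast] at h
  simpa using h

/-! ### From the Gaussian congruence (6.4) to `S_q`: the ratio `z₂/z₁ (mod Δ)` -/

/-- **(6.6)**: if `(Δ, |z₁|²) = 1` then `z₂ ≡ a z₁ (mod Δ)` for a rational integer `a`
(`a = (r₁ r₂ + s₁ s₂) · |z₁|⁻² (mod Δ)`). [cite: FriedlanderIwaniecAnnals1998, (6.6)] -/
theorem exists_ratio_mod_det {z₁ z₂ : ℤ × ℤ} (h1 : IsCoprime (det2 z₁ z₂) (z₁.1 ^ 2 + z₁.2 ^ 2)) :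
    ∃ a : ℤ, det2 z₁ z₂ ∣ z₂.1 - a * z₁.1 ∧ det2 z₁ z₂ ∣ z₂.2 - a * z₁.2 := by
  obtain ⟨u, m, hum⟩ := h1
  refine ⟨(z₁.1 * z₂.1 + z₁.2 * z₂.2) * m, ⟨u * z₂.1 - m * z₁.2, ?_⟩, ⟨u * z₂.2 + m * z₁.1, ?_⟩⟩
  · unfold det2 at hum ⊢
    linear_combination (-z₂.1) * hum
  · unfold det2 at hum ⊢
    linear_combination (-z₂.2) * hum

/-- With `z₂ ≡ a z₁ (mod Δ)` and `(Δ, |z₂|²) = 1`, the ratio `a` is prime to `Δ`.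
[cite: FriedlanderIwaniecAnnals1998, (6.6)] -/
theorem isCoprime_ratio {z₁ z₂ : ℤ × ℤ} {a : ℤ} (ha : det2 z₁ z₂ ∣ z₂.1 - a * z₁.1 ∧ det2 z₁ z₂ ∣ z₂.2 - a * z₁.2)
    (h2 : IsCoprime (det2 z₁ z₂) (z₂.1 ^ 2 + z₂.2 ^ 2)) : IsCoprime a (det2 z₁ z₂) := by
  obtain ⟨⟨k₁, hk₁⟩, ⟨k₂, hk₂⟩⟩ := ha
  obtain ⟨u, m, hum⟩ := h2
  set Δ := det2 z₁ z₂
  -- `|z₂|² = a² |z₁|² + Δ K`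
  have hr : z₂.1 = a * z₁.1 + Δ * k₁ := by linear_combination hk₁
  have hs : z₂.2 = a * z₁.2 + Δ * k₂ := by linear_combination hk₂
  refine ⟨m * a * (z₁.1 ^ 2 + z₁.2 ^ 2), u + m * (2 * a * z₁.1 * k₁ + Δ * k₁ ^ 2 + 2 * a * z₁.2 * k₂ + Δ * k₂ ^ 2), ?_⟩
  rw [hr, hs] at hum
  linear_combination hum

/-- **(6.4) is one rational congruence**: with `z₂ ≡ a z₁ (mod Δ)` and `(Δ, |z₁|²) = 1`,
`c₁² z₂ ≡ c₂² z₁ (mod Δ) ↔ Δ ∣ a c₁² - c₂²`. [cite: FriedlanderIwaniecAnnals1998, (6.4)-(6.6)] -/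
theorem congrPair_iff_dvd {z₁ z₂ : ℤ × ℤ} {a : ℤ}
    (ha : det2 z₁ z₂ ∣ z₂.1 - a * z₁.1 ∧ det2 z₁ z₂ ∣ z₂.2 - a * z₁.2)
    (h1 : IsCoprime (det2 z₁ z₂) (z₁.1 ^ 2 + z₁.2 ^ 2)) (c : ℤ × ℤ) :
    CongrPair z₁ z₂ c ↔ det2 z₁ z₂ ∣ a * c.1 ^ 2 - c.2 ^ 2 := by
  obtain ⟨⟨k₁, hk₁⟩, ⟨k₂, hk₂⟩⟩ := ha
  set Δ := det2 z₁ z₂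
  set t := a * c.1 ^ 2 - c.2 ^ 2 with ht
  have hr : z₂.1 = a * z₁.1 + Δ * k₁ := by linear_combination hk₁
  have hs : z₂.2 = a * z₁.2 + Δ * k₂ := by linear_combination hk₂
  have e1 : c.1 ^ 2 * z₂.2 - c.2 ^ 2 * z₁.2 = t * z₁.2 + Δ * (k₂ * c.1 ^ 2) := by rw [hs, ht]; ring
  have e2 : c.2 ^ 2 * z₁.1 - c.1 ^ 2 * z₂.1 = -(t * z₁.1) + Δ * (-(k₁ * c.1 ^ 2)) := by rw [hr, ht]; ring
  unfold CongrPair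
  rw [e1, e2, dvd_add_left (dvd_mul_right _ _), dvd_add_left (dvd_mul_right _ _), dvd_neg]
  constructor
  · rintro ⟨hS, hR⟩
    have h3 : Δ ∣ t * (z₁.1 ^ 2 + z₁.2 ^ 2) := by
      have := dvd_add (Dvd.dvd.mul_right hR z₁.1) (Dvd.dvd.mul_right hS z₁.2)
      have e : t * z₁.1 * z₁.1 + t * z₁.2 * z₁.2 = t * (z₁.1 ^ 2 + z₁.2 ^ 2) := by ring
      rwa [e] at this
    exact h1.dvd_of_dvd_mul_right h3
  · intro h
    exact ⟨Dvd.dvd.mul_right h _, Dvd.dvd.mul_right h _⟩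

/-- `|Δ| G(h₁, h₂)` of (6.10): the complete exponential sum over the pairs of classes
`γ₁, γ₂ (mod |Δ|)` satisfying (6.4). [cite: FriedlanderIwaniecAnnals1998, (6.10)] -/
def gExpSum (z₁ z₂ : ℤ × ℤ) (h₁ h₂ : ℤ) : ℂ :=
  ∑ γ₁ ∈ range (det2 z₁ z₂).natAbs, ∑ γ₂ ∈ range (det2 z₁ z₂).natAbs,
    if CongrPair z₁ z₂ ((γ₁ : ℤ), (γ₂ : ℤ)) then
      (𝐞 (((γ₁ : ℝ) * h₁ + (γ₂ : ℝ) * h₂) / (det2 z₁ z₂).natAbs) : ℂ) else 0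

/-- `|Δ| G₀(z₁, z₂)` of (6.12): the number of pairs of classes `γ₁, γ₂ (mod |Δ|)` satisfying (6.4).
[cite: FriedlanderIwaniecAnnals1998, (6.12)] -/
def gCount (z₁ z₂ : ℤ × ℤ) : ℕ :=
  #(((range (det2 z₁ z₂).natAbs) ×ˢ (range (det2 z₁ z₂).natAbs)).filter fun γ : ℕ × ℕ =>
    CongrPair z₁ z₂ ((γ.1 : ℤ), (γ.2 : ℤ)))

/-- `|Δ| G = S_{|Δ|}(a; ·)` with `a = z₂/z₁ (mod Δ)`. [cite: FriedlanderIwaniecAnnals1998, (6.10), (8.2)-(8.3)] -/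
theorem gExpSum_eq_quadExpSum {z₁ z₂ : ℤ × ℤ} {a : ℤ}
    (ha : det2 z₁ z₂ ∣ z₂.1 - a * z₁.1 ∧ det2 z₁ z₂ ∣ z₂.2 - a * z₁.2)
    (h1 : IsCoprime (det2 z₁ z₂) (z₁.1 ^ 2 + z₁.2 ^ 2)) (h₁ h₂ : ℤ) :
    gExpSum z₁ z₂ h₁ h₂ = quadExpSum (det2 z₁ z₂).natAbs a h₁ h₂ := by
  unfold gExpSum quadExpSum
  refine sum_congr rfl fun x _ => sum_congr rfl fun y _ => ?_
  have e : CongrPair z₁ z₂ ((x : ℤ), (y : ℤ)) ↔ (((det2 z₁ z₂).natAbs : ℕ) : ℤ) ∣ a * (x : ℤ) ^ 2 - (y : ℤ) ^ 2 := by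
    rw [congrPair_iff_dvd ha h1, Int.natAbs_dvd]
  by_cases hc : CongrPair z₁ z₂ ((x : ℤ), (y : ℤ))
  · rw [if_pos hc, if_pos (e.mp hc)]
  · rw [if_neg hc, if_neg (fun h => hc (e.mpr h))]

/-- `|Δ| G₀ = N(a; |Δ|)`. [cite: FriedlanderIwaniecAnnals1998, (8.8)] -/
theorem gCount_eq {z₁ z₂ : ℤ × ℤ} {a : ℤ}
    (ha : det2 z₁ z₂ ∣ z₂.1 - a * z₁.1 ∧ det2 z₁ z₂ ∣ z₂.2 - a * z₁.2)
    (h1 : IsCoprime (det2 z₁ z₂) (z₁.1 ^ 2 + z₁.2 ^ 2)) :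
    gCount z₁ z₂ = #(((range (det2 z₁ z₂).natAbs) ×ˢ (range (det2 z₁ z₂).natAbs)).filter
      fun γ : ℕ × ℕ => (((det2 z₁ z₂).natAbs : ℕ) : ℤ) ∣ a * (γ.1 : ℤ) ^ 2 - (γ.2 : ℤ) ^ 2) := by
  unfold gCount
  congr 1
  refine filter_congr fun γ _ => ?_
  rw [congrPair_iff_dvd ha h1, Int.natAbs_dvd]

/-- The gcd `(Λ, Δ)` of (8.5) with `Λ = z₁ h₁² - z₂ h₂²` a Gaussian integer equals `(h₁² - a h₂², Δ)`.
[cite: FriedlanderIwaniecAnnals1998, (8.5)] -/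
theorem gcd_lambda_eq {z₁ z₂ : ℤ × ℤ} {a : ℤ}
    (ha : det2 z₁ z₂ ∣ z₂.1 - a * z₁.1 ∧ det2 z₁ z₂ ∣ z₂.2 - a * z₁.2)
    (h1 : IsCoprime (det2 z₁ z₂) (z₁.1 ^ 2 + z₁.2 ^ 2)) (h₁ h₂ : ℤ) :
    Nat.gcd (Nat.gcd (z₁.1 * h₁ ^ 2 - z₂.1 * h₂ ^ 2).natAbs (z₁.2 * h₁ ^ 2 - z₂.2 * h₂ ^ 2).natAbs)
      (det2 z₁ z₂).natAbs = Nat.gcd (h₁ ^ 2 - a * h₂ ^ 2).natAbs (det2 z₁ z₂).natAbs := by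
  obtain ⟨⟨k₁, hk₁⟩, ⟨k₂, hk₂⟩⟩ := ha
  set Δ := det2 z₁ z₂
  set L := h₁ ^ 2 - a * h₂ ^ 2 with hL
  have hr : z₂.1 = a * z₁.1 + Δ * k₁ := by linear_combination hk₁
  have hs : z₂.2 = a * z₁.2 + Δ * k₂ := by linear_combination hk₂
  have eR : z₁.1 * h₁ ^ 2 - z₂.1 * h₂ ^ 2 = z₁.1 * L + Δ * (-(k₁ * h₂ ^ 2)) := by rw [hr, hL]; ring
  have eI : z₁.2 * h₁ ^ 2 - z₂.2 * h₂ ^ 2 = z₁.2 * L + Δ * (-(k₂ * h₂ ^ 2)) := by rw [hs, hL]; ring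
  -- for `g ∣ Δ`: `g ∣ Re Λ ∧ g ∣ Im Λ ↔ g ∣ L`
  have key : ∀ g : ℕ, (g : ℤ) ∣ Δ →
      ((g : ℤ) ∣ z₁.1 * h₁ ^ 2 - z₂.1 * h₂ ^ 2 ∧ (g : ℤ) ∣ z₁.2 * h₁ ^ 2 - z₂.2 * h₂ ^ 2 ↔ (g : ℤ) ∣ L) := by
    intro g hg
    rw [eR, eI, dvd_add_left (Dvd.dvd.mul_right hg _), dvd_add_left (Dvd.dvd.mul_right hg _)]
    constructor
    · rintro ⟨hR, hI⟩
      have h3 : (g : ℤ) ∣ L * (z₁.1 ^ 2 + z₁.2 ^ 2) := by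
        have := dvd_add (Dvd.dvd.mul_right hR z₁.1) (Dvd.dvd.mul_right hI z₁.2)
        have e : z₁.1 * L * z₁.1 + z₁.2 * L * z₁.2 = L * (z₁.1 ^ 2 + z₁.2 ^ 2) := by ring
        rwa [e] at this
      exact (h1.of_isCoprime_of_dvd_left hg).dvd_of_dvd_mul_right h3
    · intro h
      exact ⟨Dvd.dvd.mul_left h _, Dvd.dvd.mul_left h _⟩
  apply Nat.dvd_antisymm
  · refine Nat.dvd_gcd ?_ (Nat.gcd_dvd_right _ _)
    have hg : ((Nat.gcd (Nat.gcd (z₁.1 * h₁ ^ 2 - z₂.1 * h₂ ^ 2).natAbs (z₁.2 * h₁ ^ 2 - z₂.2 * h₂ ^ 2).natAbs)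
        Δ.natAbs : ℕ) : ℤ) ∣ Δ := Int.natCast_dvd.mpr (Nat.gcd_dvd_right _ _)
    refine Int.natCast_dvd.mp ((key _ hg).mp ⟨?_, ?_⟩)
    · exact Int.natCast_dvd.mpr ((Nat.gcd_dvd_left _ _).trans (Nat.gcd_dvd_left _ _))
    · exact Int.natCast_dvd.mpr ((Nat.gcd_dvd_left _ _).trans (Nat.gcd_dvd_right _ _))
  · refine Nat.dvd_gcd ?_ (Nat.gcd_dvd_right _ _)
    have hg : ((Nat.gcd L.natAbs Δ.natAbs : ℕ) : ℤ) ∣ Δ := Int.natCast_dvd.mpr (Nat.gcd_dvd_right _ _)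
    have hgL : ((Nat.gcd L.natAbs Δ.natAbs : ℕ) : ℤ) ∣ L := Int.natCast_dvd.mpr (Nat.gcd_dvd_left _ _)
    obtain ⟨hR, hI⟩ := (key _ hg).mpr hgL
    exact Nat.dvd_gcd (Int.natCast_dvd.mp hR) (Int.natCast_dvd.mp hI)

/-- **FI Lemma 8.1 (crude form).** Let `z₁ = (r₁, s₁)`, `z₂ = (r₂, s₂)` with `Δ = r₁ s₂ - r₂ s₁ ≠ 0`
and `(Δ, |z₁|²) = (Δ, |z₂|²) = 1`. Then for all `h₁, h₂` the exponential sum (6.10) satisfies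
`|Δ| |G(h₁, h₂)| ≤ τ(|Δ|)⁴ (Λ, Δ)`, where `Λ = z₁ h₁² - z₂ h₂²` and `(Λ, Δ)` is the gcd of `Δ` with
both coordinates of `Λ`. The source has `4 τ₃(Δ)` for `τ(|Δ|)⁴`.
[cite: FriedlanderIwaniecAnnals1998, Lemma 8.1, (8.5)] -/
theorem norm_gExpSum_le {z₁ z₂ : ℤ × ℤ} (hΔ : det2 z₁ z₂ ≠ 0)
    (h1 : IsCoprime (det2 z₁ z₂) (z₁.1 ^ 2 + z₁.2 ^ 2)) (h2 : IsCoprime (det2 z₁ z₂) (z₂.1 ^ 2 + z₂.2 ^ 2))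
    (h₁ h₂ : ℤ) :
    ‖gExpSum z₁ z₂ h₁ h₂‖ ≤ (#(det2 z₁ z₂).natAbs.divisors : ℝ) ^ 4 *
      Nat.gcd (Nat.gcd (z₁.1 * h₁ ^ 2 - z₂.1 * h₂ ^ 2).natAbs (z₁.2 * h₁ ^ 2 - z₂.2 * h₂ ^ 2).natAbs)
        (det2 z₁ z₂).natAbs := by
  obtain ⟨a, ha⟩ := exists_ratio_mod_det h1
  have hcop : IsCoprime a (((det2 z₁ z₂).natAbs : ℕ) : ℤ) := by
    rw [Int.natCast_natAbs]
    exact (isCoprime_ratio ha h2).abs_right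
  rw [gExpSum_eq_quadExpSum ha h1, gcd_lambda_eq ha h1]
  exact norm_quadExpSum_le (Int.natAbs_pos.mpr hΔ) hcop h₁ h₂

/-- **(8.6) (crude form)**: `|Δ| G₀(z₁, z₂) ≤ τ(|Δ|)⁴ |Δ|` under the hypotheses of Lemma 8.1
(the source: `G₀ ≤ 4 τ₃(Δ)`). [cite: FriedlanderIwaniecAnnals1998, (8.6)] -/
theorem gCount_le {z₁ z₂ : ℤ × ℤ} (hΔ : det2 z₁ z₂ ≠ 0)
    (h1 : IsCoprime (det2 z₁ z₂) (z₁.1 ^ 2 + z₁.2 ^ 2)) (h2 : IsCoprime (det2 z₁ z₂) (z₂.1 ^ 2 + z₂.2 ^ 2)) :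
    (gCount z₁ z₂ : ℝ) ≤ (#(det2 z₁ z₂).natAbs.divisors : ℝ) ^ 4 * (det2 z₁ z₂).natAbs := by
  obtain ⟨a, ha⟩ := exists_ratio_mod_det h1
  have hcop : IsCoprime a (((det2 z₁ z₂).natAbs : ℕ) : ℤ) := by
    rw [Int.natCast_natAbs]
    exact (isCoprime_ratio ha h2).abs_right
  rw [gCount_eq ha h1]
  exact card_quadPairs_le (Int.natAbs_pos.mpr hΔ) hcop

end Literature.NumberTheory.Sieve.FriedlanderIwaniecPrimes
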